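import Summits.RiemannHypothesis.RiemannHypothesis.Theses.RuelleBand
import Literature.NumberTheory.LFunctions.RHWave0HardyProofs
import Literature.NumberTheory.LFunctions.GeneralizedRH
import Literature.Barriers.RiemannHypothesis.DavenportHeilbronnProofs
import Literature.NumberTheory.LFunctions.DeBruijnHZeroProofs
import Literature.NumberTheory.LFunctions.RiemannXiProofs
import Literature.NumberTheory.LFunctions.DeBruijnNewmanFacts
import Literature.NumberTheory.LFunctions.DeBruijnHHeatFlow
import Literature.Analysis.Complex.Hurwitz
import Literature.Analysis.Complex.LittlewoodLemma
import Literature.NumberTheory.LFunctions.ZetaLogDerivRePartialFraction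
import Literature.NumberTheory.LFunctions.ZetaZerosProofs
import Literature.NumberTheory.LFunctions.ZetaZerosReflection

/-!
# Disproof of `CofiniteCriticalLine` (crux stmt-RiemannHypothesis-2064) — standing adversary's work file

Crux (route RuelleBand, rank 5):
`CofiniteCriticalLine : Prop := {s : ℂ | riemannZeta s = 0 ∧ 0 < s.re ∧ s.re < 1 ∧ s.re ≠ 1 / 2}.Finite`
("all but finitely many non-trivial zeros of `ζ` lie on the critical line").

Findings (all `lean check`ed, sorry-free unless marked NEAR-MISS; cycle 1 = §§0–6, cycle 2 = §§7–8, 2026-08-16):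

* §1 WHY IT RESISTS DISPROOF.
  - `cofiniteCriticalLine_of_riemannHypothesis : RiemannHypothesis → CofiniteCriticalLine` (the exceptional
    set is EMPTY under RH), hence `¬ CofiniteCriticalLine → ¬ RiemannHypothesis`: a kill of this crux is a
    disproof of RH (kill criterion (iv) of the route, now a Lean theorem).
  - `riemannHypothesis_iff_offLine_eq_empty` and `cofiniteCriticalLine_iff_rh_or_finitely_many_exceptions`:
    the crux is exactly "RH, or finitely many (≥ 1) exceptions" — the standing hypothesis of
    Bombieri 2000 (Rend. Lincei (9) 11, Thms 10–11), under which no contradiction is known.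
  - `cofiniteCriticalLine_iff_diff_finite`: removing ANY finite set of (putative, computed) off-line zeros
    does not change the truth value — the crux is a Σ₂ statement, NOT REFUTABLE BY ANY FINITE COMPUTATION;
    only an infinite family of off-line zeros kills it. No `kit compute` search is meaningful (recorded, none run).
  - `cofiniteCriticalLine_iff_eventually_on_line`: crux ⟺ "RH above some height T" (finitely many ⟺
    bounded height, by discreteness of the zeros: Mathlib `IsCompact.inter_riemannZetaZeros_finite`).
  - `cofiniteCriticalLine_iff_rh_of_zoi`: under the open dichotomy ZOI (card zero-or-infinity-offline) the crux
    IS RH; `infinite_near_line_of_asymptotic_of_not_cofinite`: any kill consistent with rung #4 is an infinite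
    family of off-line zeros converging to the line and escaping to infinite height.
* §2 LOAD-BEARING ANALYSIS of the four conjuncts of the set-builder:
  - drop `s.re ≠ 1/2` ⇒ FALSE (`cofiniteCriticalLine_false_without_neHalf`, by Hardy 1914, PROVED in tree:
    `hardy_infinite_zeros_on_critical_line_holds`);
  - drop `0 < s.re` ⇒ FALSE (`cofiniteCriticalLine_false_without_rePos`: the trivial zeros `-2(n+1)`);
  - drop `riemannZeta s = 0` ⇒ FALSE (`cofiniteCriticalLine_false_without_zeta`, witness `1/4 + n i`);
  - drop `s.re < 1` ⇒ EQUIVALENT (`cofiniteCriticalLine_iff_without_ltOne`): the conjunct `s.re < 1` is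
    decoration for `ζ` (no zeros on `re s ≥ 1`, Mathlib `riemannZeta_ne_zero_of_one_le_re`) — but see §4(c):
    it is exactly this redundancy that fails for Davenport–Heilbronn.
* §3 REFORMULATIONS the provers may use (symmetries `s ↦ 1 - s`, `s ↦ conj s` of the zero set):
  crux ⟺ `rightHalf.Finite` (= FIN of idea card zero-or-infinity-offline) ⟺ `leftHalf.Finite`
  ⟺ upper-half-plane part finite ⟺ open quadrant `{1/2 < re < 1, 0 < im}` part finite.
* §4 NATURAL STRENGTHENINGS / ABSTRACTIONS REFUTED by small models:
  - (a) `not_abstract_asymptotic_imp_cofinite`: rung #4's SHAPE does not give rung #5's shape for an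
    abstract "zero set" (witness `Z = {1/2 + 1/(n+2) + n i}`): the converse of `LadderGlue.2` is not formal;
  - (b) `not_abstract_cofinite_imp_exact`: rung #5's shape does not give X's shape (witness `{1 + i}`-type
    point `3/4 + i`): "exceptional zeros are real" is genuine input;
  - (c) `not_cofinite_shape_davenportHeilbronn`: the crux in its `ζ`-equivalent form of §2
    (`{L = 0 ∧ 0 < re ∧ re ≠ 1/2}.Finite`) is FALSE for the Davenport–Heilbronn function (PROVED in tree:
    `Literature.Barriers.RiemannHypothesis.DavenportHeilbronn_holds`, infinitely many zeros in `re s > 1`):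
    any proof must use input beyond "Dirichlet series + degree-one functional equation" — the Euler product —
    already to confine the zeros to `re s < 1` (barrier `DavenportHeilbronn`, technique class
    functional-equation-only).
* §5 LADDER POSITION: `ExactFirstBand → CofiniteCriticalLine → AsymptoticCriticalLine`, `RH → ExactFirstBand`
  (copies for the provers of `LadderGlue`; all one-liners).
* §6 THE CRUX IS KI–KIM–LEE AT `t = 0` (de Bruijn deformation `H_t` of `H_0 = ξ(1/2 + iz/2)/8`):
  `cofiniteCriticalLine_iff_kiKimLee_at_zero : crux ↔ ∃ T, ∀ z, H_0 z = 0 → T ≤ |Re z| → Im z = 0` — verbatim the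
  conclusion of Ki–Kim–Lee 2009 Thm 1.3 (tree named fact `ki_kim_lee_finite`, PRINTED for every `t > 0`) at the
  excluded endpoint; `kiKimLee_at_zero_of_uniform` (Hurwitz): ONE threshold for all `t ∈ (0, δ)` gives the crux;
  `kiKimLee_thresholds_unbounded_of_not_cofinite`: a kill forces non-real zeros of `H_t` (`t ↓ 0`) at arbitrarily
  large `|Re z|` — the KKL thresholds `T(t)` must blow up. (Landing copies: Negative/KiKimLeeEndpoint.lean,
  Negative/KiKimLeeUniform.lean.)
* §7 (cycle 2) THE CRUX IS COFINITE LAGARIAS POSITIVITY / COFINITE SONDOW–DUMITRESCU MONOTONICITY (R1 of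
  ObstructionsR1K3.md made a theorem; LANDED as Negative/HorizontalMonotonicity.lean p76385 + Negative/CollarCostume.lean
  p77656; `rateBand_of_neg_exponent`, `collarMono_of_nonpos`, `not_monotoneOn_collar_at_offLine_zero` live only here):
  - `re_logDeriv_riemannXi_pos_of_offLine` — POINTWISE SYMMETRISED CRITERION: if `re s > 1/2` and every off-line
    zero `β + iγ` has `(β − 1/2)² < (σ − 1/2)² + (t − γ)²`, then `Re ξ'/ξ(s) > 0` (tree partial fraction
    `hasSum_zeroOrder_mul_re_inv_sub` with multiplicities, re-indexed by `ρ ↦ 1 − ρ̄`; pair identity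
    `(x−a)/((x−a)²+u²) + (x+a)/((x+a)²+u²) = 2x(x²−a²+u²)/D`: a symmetric pair pushes `|ξ|` OUTWARD at every point
    outside the disc of radius `|β − 1/2|` about `1/2 + iγ`). Unconditional corollaries: `Re ξ'/ξ > 0` on `re s ≥ 1`
    (Lagarias (1.4), closed half-plane) and at every height `t` at distance `≥ 1/2` from all off-line ordinates.
  - `cofiniteCriticalLine_iff_eventually_re_logDeriv_pos : crux ↔ ∃ T, ∀ σ > 1/2, |t| ≥ T, 0 < Re ξ'/ξ(σ+it)`;
    `cofiniteCriticalLine_iff_eventually_strictMonoOn : crux ↔ ∃ T, ∀ |t| ≥ T, σ ↦ |ξ(σ+it)| strictly increasing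
    on [1/2, ∞)` (MSZ Lemma 2.3 shape via `hasDerivAt_log_norm_horizontal`; `⟸` cheap: `logDeriv` is `0` at a zero /
    isolated zeros of `ξ`).
  - CONSEQUENCES FOR IDEA rate-band-collar-split (SketchIdeator3.lean; bodies restated verbatim): the crux IMPLIES
    `CollarMono ε C T₂` at EVERY rate and `FixedCollarMono ε₀ T` at every width (`collarMono_of_cofinite`,
    `fixedCollarMono_of_cofinite`), and `RateBand ε C T₁` for every `C ≥ 0` (`rateBand_of_cofinite`), so the idea's
    `SplitExact` is PROVED (`splitExact_of_cofinite`); conversely `FixedCollarMono ε₀ T` with `ε₀ ≥ 1/2` ALONE gives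
    the crux (`cofinite_of_fixedCollarMono`; no rung #4 needed) — `fixedCollarMono_iff_cofinite`: at macroscopic
    width the near half IS the crux (costume); at shrinking width it is implied by the crux and, given the far half,
    implies it (the idea's `firstLemma_holds`) — the split RELOCATES the difficulty into `RateBand(η)`, it does not
    divide it; what decides the collar at height `t` is the off-line zeros at heights within `1/2` of `t`
    (`strictMonoOn_norm_riemannXi_of_offLine_height`). Degenerate parameters: `RateBand ε C T` is FALSE for `C < 0`
    (`not_rateBand_of_neg`, Hardy + discreteness), is the whole crux for `C = 0` (`rateBand_zero_iff_cofinite`),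
    and holds UNCONDITIONALLY for a negative exponent `ε < 0`, `C > 0` (`rateBand_of_neg_exponent`: the band widens);
    `CollarMono ε C T₂` is vacuous for `C ≤ 0` (`collarMono_of_nonpos`). So the idea's parameters carry content only
    for `ε ≥ 0`, `C > 0` (far half between rungs #4 and #5) — and there the near half is free (above). Pointwise, the
    near half's ENTIRE zero-side content is `not_monotoneOn_collar_at_offLine_zero`: at the ordinate of an off-line zero
    `β₀ + iγ₀` monotonicity fails on every collar of width `≥ β₀ − 1/2`, so `CollarMono(η)` at height `γ₀` implies
    "no off-line zero at height `γ₀` within `η(γ₀)` of the line" (and is implied by their absence at heights within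
    `1/2` of `γ₀`).
  - PAPER AUDIT of the other r1 levers (no Lean kill exists): both typings of `PontryaginEngine` (ideator 1: form
    non-expanding group with non-positive subspaces of dim ≤ κ; ideator 2: `J`-unitary group, `J` self-adjoint
    involution with `range (1 − J)` finite-dimensional) are TRUE as typed — expanding joint eigenvectors span a
    `q`-non-positive (resp. `J`-neutral) subspace, eigenvectors of distinct joint characters are independent, so
    `#{Re z > 0 characters} ≤ κ`; `PontryaginCalibration` holds by `ℓ² ⊕ (2×2 hyperbolic blocks, J = σₓ)`;
    `KreinZeroCount` passes the `n = 1` checks in both signatures (`w(0) = ±1`) and 1000+ random Hermitian Toeplitz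
    trials for `n = 1..5` (pure-python: Jacobi sign changes vs Durand–Kerner roots of `Σ ωᵢ zⁱ`, `ω = Ωₙ⁻¹ e_last`;
    evidence `krein_check.py` on the item — note the `e_last` convention matters: with `e_first` the count flips to
    roots INSIDE the disc); `WeilIndexOnLE a N` is well-posed on
    dependent tuples (`c` with `Σ cᵢ gᵢ = 0`). These engines carry no arithmetic: every ∃-typed realisation is
    ⟺ crux (the cards say so); nothing to refute.
* §8 (cycle 2; LANDED as Negative/LaguerreAllOrders.lean p77797) `cofinite_of_eventualLaguerreAllOrders` — the idea's `EventualLaguerreAllOrders T₂` (all even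
  `x`-derivatives of `|ξ(1/2 + x + it)|²` at `x = 0` nonnegative for `|t| ≥ T₂`; offered as a "crude sufficient
  condition" for the NEAR half) implies the crux BY ITSELF: at an off-line zero `β + it` the entire symmetric square
  `G(w) = ξ(1/2+w+it)ξ(1/2−w+it)` has real Taylor coefficients `g⁽ⁿ⁾(0)/n!` at `0` (`iteratedDeriv_ofReal_eq`), zero
  for odd `n` (evenness), `≥ 0` for even `n`; its Taylor series at `β − 1/2 > 0` sums to `|ξ(β+it)|² = 0`, so
  `G ≡ 0` — contradiction. With the (paper) converse via Csordas–Varga, `∃ T₂, EventualLaguerreAllOrders T₂ ⟺ crux`: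
  like `FixedCollarMono (ε₀ ≥ 1/2)`, every all-orders positivity / macroscopic monotonicity statement about `|ξ|`
  near the line is the crux in costume; only SHRINKING-collar statements paired with a RATE are genuinely partial,
  and then the content sits in the rate (far half).
* BY-PRODUCT (cycle 2): the pointwise criterion discharges the tree's named facts `Lagarias1999_re_logDeriv_riemannXi_pos`
  (1.4) and `Lagarias1999_riemannHypothesis_iff` (1.5) — self-contained Literature proof file LANDED as p79000
  (`Literature/NumberTheory/LFunctions/LagariasXiPositivityEq14Proofs.lean`, review-accepted, debt −2). Reviewer's
  follow-up for the route owner: let Negative/HorizontalMonotonicity.lean import that file and drop its 11 duplicate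
  helpers (namespace `Literature.NumberTheory.LFunctions.Lagarias1999Eq14`).
* NEAR-MISSES: none (nothing is sorried).  Targets (lead's stuck stubs): none handed over (no line picked yet).
* Literature negatives: no theorem in print produces infinitely many off-line zeros of `ζ` (that is `¬RH`
  infinitely often); `ledger negatives --problem RiemannHypothesis`: 0 entries; the analogue of the crux is
  false for Davenport–Heilbronn / Epstein (class number > 1) / Beurling systems (Barriers catalogue:
  DavenportHeilbronn, EpsteinZeta*, BeurlingCounterexamples) — all outside the Euler-product class.
  VERIFIED WORDING (Bombieri2000Weil, read at page level this cycle, galaxy copy pdf:4005501466549090220):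
  Thm 10 (p. 32 of the pdf) and Thm 11 (p. 34): "Suppose ζ(s) has only finitely many non-trivial zeros 1/2 + iγ
  with γ ∉ ℝ, and at least one such zero" = `CofiniteCriticalLine ∧ ¬RH` (our
  `cofiniteCriticalLine_iff_rh_or_finitely_many_exceptions`); the conclusions are non-trivial eigenvector / linear
  relations, NOT a contradiction. Corollary after Thm 11 (p. 35) is the printed trichotomy: "either the Riemann
  Hypothesis is true, or ζ(s) has infinitely many zeros off the critical line, or the functions x^{-ρ} are linearly
  dependent over 𝓔 [with ≥ 1/2 of the ℓ²-mass on the off-line zeros]" — i.e. RH ∨ ¬crux ∨ (linear dependence);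
  Bombieri: the independence question is "probably quite difficult", and such relations DO occur for Dedekind zeta
  functions (example p. 35: two Dirichlet L-functions of equal conductor and parity). So in print the scenario
  "crux ∧ ¬RH" is alive, carrying only this linear-dependence consequence; §13 (pp. 37–38) even runs numerics with
  a fictitious off-line zero ρ₀ = 0.52 + 3.14i added to the first N ≤ 160 zeros without inconsistency.
  Ki–Kim–Lee 2009 (doi:10.1016/j.aim.2009.04.003) is paywalled (acq-00145): the t-dependence of their threshold
  T(t) in Thm 1.3 is NOT verified here; heuristically T(t) ~ exp(c/t) (a complex zero of H_0 at height X collapses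
  under the flow in time ~ y / (c log X)), so §6's uniformity is as hard as the crux, not a shortcut.
-/

noncomputable section

open Complex Set
open scoped ComplexConjugate

namespace Summit.RiemannHypothesis.RiemannHypothesis.Cruxes.CofiniteCriticalLine.Disproof

open Summit.RiemannHypothesis.RiemannHypothesis.Theses.RuelleBand
open Literature.NumberTheory.LFunctions

/-! ## §0 The exceptional set -/

/-- The exceptional set of the crux: zeros of `ζ` in the open critical strip off the critical line. -/
def offLine : Set ℂ := {s : ℂ | riemannZeta s = 0 ∧ 0 < s.re ∧ s.re < 1 ∧ s.re ≠ 1 / 2}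

/-- Unfolding: the crux says `offLine` is finite. -/
theorem cofiniteCriticalLine_iff : CofiniteCriticalLine ↔ offLine.Finite := Iff.rfl

/-- A trivial zero `-2(n+1)` is the real number `-2(n+1)`. -/
theorem trivialZero_eq_ofReal (n : ℕ) : (-2 * ((n : ℂ) + 1)) = ((-2 * ((n : ℝ) + 1) : ℝ) : ℂ) := by
  push_cast; ring

/-- Members of the exceptional set are not trivial zeros. -/
theorem not_trivial_of_re_pos {s : ℂ} (h0 : 0 < s.re) : ¬ ∃ n : ℕ, s = -2 * (n + 1) := by
  rintro ⟨n, hn⟩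
  have hre := congrArg Complex.re hn
  rw [trivialZero_eq_ofReal, ofReal_re] at hre
  have : (0 : ℝ) ≤ n := n.cast_nonneg
  linarith

/-! ## §1 Why it resists: a kill is a disproof of RH, and no finite computation can kill it -/

/-- Under RH the exceptional set is empty. -/
theorem offLine_eq_empty_of_riemannHypothesis (h : RiemannHypothesis) : offLine = ∅ := by
  refine Set.subset_empty_iff.1 fun s hs => ?_
  obtain ⟨hz, h0, h1, hne⟩ := hs
  refine absurd (h s hz (not_trivial_of_re_pos h0) ?_) hne
  rintro rfl
  norm_num at h1

/-- RH implies the crux (the exceptional set is empty, hence finite). -/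
theorem cofiniteCriticalLine_of_riemannHypothesis (h : RiemannHypothesis) : CofiniteCriticalLine := by
  rw [cofiniteCriticalLine_iff, offLine_eq_empty_of_riemannHypothesis h]
  exact Set.finite_empty

/-- Contrapositive: a disproof of the crux is a disproof of the Riemann Hypothesis. -/
theorem not_riemannHypothesis_of_not_cofiniteCriticalLine (h : ¬ CofiniteCriticalLine) :
    ¬ RiemannHypothesis :=
  mt cofiniteCriticalLine_of_riemannHypothesis h

/-- The same against the summit statement (definitionally Mathlib's `RiemannHypothesis`). -/
theorem not_summit_of_not_cofiniteCriticalLine (h : ¬ CofiniteCriticalLine) :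
    ¬ _root_.Summit.RiemannHypothesis :=
  fun hS => not_riemannHypothesis_of_not_cofiniteCriticalLine h (Summit.RiemannHypothesis_iff.1 hS)

/-- RH is exactly "the exceptional set is empty" (uses the proved tree fact
`riemannHypothesis_iff_strip_holds`: zeros with `re s ≤ 0` are trivial). -/
theorem riemannHypothesis_iff_offLine_eq_empty : RiemannHypothesis ↔ offLine = ∅ := by
  refine ⟨offLine_eq_empty_of_riemannHypothesis, fun h => ?_⟩
  rw [show RiemannHypothesis ↔ RiemannHypothesisStrip from riemannHypothesis_iff_strip_holds]
  intro s hz h0 h1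
  by_contra hne
  have hs : s ∈ offLine := ⟨hz, h0, h1, hne⟩
  rw [h] at hs
  exact hs

/-- The crux is "RH, or finitely many but at least one exception" — the standing hypothesis of
Bombieri 2000, Thms 10–11, under which no contradiction is known. -/
theorem cofiniteCriticalLine_iff_rh_or_finitely_many_exceptions :
    CofiniteCriticalLine ↔ RiemannHypothesis ∨ (offLine.Finite ∧ offLine.Nonempty) := by
  rw [cofiniteCriticalLine_iff, riemannHypothesis_iff_offLine_eq_empty]
  constructor
  · intro h
    rcases offLine.eq_empty_or_nonempty with he | hne
    · exact Or.inl he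
    · exact Or.inr ⟨h, hne⟩
  · rintro (he | ⟨h, -⟩)
    · rw [he]; exact Set.finite_empty
    · exact h

/-- NOT FINITELY REFUTABLE: deleting any finite set `E` (e.g. a finite list of computed off-line zeros)
from the exceptional set does not change the truth value of the crux. A kill must exhibit an INFINITE
family of off-line zeros. -/
theorem cofiniteCriticalLine_iff_diff_finite {E : Set ℂ} (hE : E.Finite) :
    CofiniteCriticalLine ↔ (offLine \ E).Finite := by
  refine ⟨fun h => h.subset fun _ hx => hx.1, fun h => (h.union hE).subset ?_⟩
  intro s hs
  by_cases h' : s ∈ E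
  · exact Or.inr h'
  · exact Or.inl ⟨hs, h'⟩

/-- Crux ⟺ "RH holds above some height": finitely many exceptions ⟺ exceptions of bounded height
(the zeros of `ζ` in a compact set are finitely many, Mathlib `IsCompact.inter_riemannZetaZeros_finite`). -/
theorem cofiniteCriticalLine_iff_eventually_on_line :
    CofiniteCriticalLine ↔
      ∃ T : ℝ, ∀ s : ℂ, riemannZeta s = 0 → 0 < s.re → s.re < 1 → T < |s.im| → s.re = 1 / 2 := by
  constructor
  · intro h
    obtain ⟨T, hT⟩ := (h.image fun s : ℂ => |s.im|).bddAbove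
    refine ⟨T, fun s hz h0 h1 hT' => ?_⟩
    by_contra hne
    have : |s.im| ≤ T := hT ⟨s, ⟨hz, h0, h1, hne⟩, rfl⟩
    linarith
  · rintro ⟨T, hT⟩
    refine (((isCompact_Icc (a := (0 : ℝ)) (b := 1)).reProdIm
      (isCompact_Icc (a := -T) (b := T))).inter_riemannZetaZeros_finite).subset ?_
    rintro s ⟨hz, h0, h1, hne⟩
    have him : |s.im| ≤ T := not_lt.1 fun h => hne (hT s hz h0 h1 h)
    exact ⟨Complex.mem_reProdIm.2 ⟨⟨h0.le, h1.le⟩, abs_le.1 him⟩, hz⟩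

/-- Under the folklore dichotomy ZOI ("zero or infinitely many off-line zeros", idea card
zero-or-infinity-offline) the crux has exactly the strength of RH. ZOI is open; this records the dependency. -/
theorem cofiniteCriticalLine_iff_rh_of_zoi (hZOI : offLine = ∅ ∨ offLine.Infinite) :
    CofiniteCriticalLine ↔ RiemannHypothesis := by
  rw [cofiniteCriticalLine_iff, riemannHypothesis_iff_offLine_eq_empty]
  refine ⟨fun h => ?_, fun h => by rw [h]; exact Set.finite_empty⟩
  rcases hZOI with he | hinf
  · exact he
  · exact (hinf h).elim

/-- SHAPE OF ANY KILL CONSISTENT WITH RUNG #4: if `AsymptoticCriticalLine` holds but the crux fails, then for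
every `ε > 0` there are infinitely many off-line zeros with `|re s - 1/2| < ε` — a counterexample family must
converge to the critical line (and, by `cofiniteCriticalLine_iff_eventually_on_line`, escape to infinite height). -/
theorem infinite_near_line_of_asymptotic_of_not_cofinite (h4 : AsymptoticCriticalLine)
    (h5 : ¬ CofiniteCriticalLine) {ε : ℝ} (hε : 0 < ε) :
    (offLine ∩ {s : ℂ | |s.re - 1 / 2| < ε}).Infinite := by
  intro hfin
  apply h5
  rw [cofiniteCriticalLine_iff]
  refine ((h4 ε hε).union hfin).subset ?_
  intro s hs
  by_cases hlt : |s.re - 1 / 2| < ε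
  · exact Or.inr ⟨hs, hlt⟩
  · exact Or.inl ⟨hs.1, hs.2.1, hs.2.2.1, not_lt.1 hlt⟩

/-! ## §2 Load-bearing analysis: drop one conjunct of the set-builder at a time -/

/-- The crux with `s.re ≠ 1/2` dropped: "finitely many zeros in the open strip". -/
def CofiniteCriticalLineWithoutNeHalf : Prop :=
  {s : ℂ | riemannZeta s = 0 ∧ 0 < s.re ∧ s.re < 1}.Finite

/-- FALSE without `s.re ≠ 1/2`: Hardy's theorem (1914; PROVED in tree as
`hardy_infinite_zeros_on_critical_line_holds`) gives infinitely many zeros `1/2 + it`. So any proof of the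
crux must use the off-line condition (it cannot be a plain zero-counting bound). -/
theorem cofiniteCriticalLine_false_without_neHalf : ¬ CofiniteCriticalLineWithoutNeHalf := by
  intro hfin
  have himg : ((fun t : ℝ => (1 / 2 : ℂ) + t * I) '' {t : ℝ | riemannZeta (1 / 2 + t * I) = 0}).Finite := by
    refine hfin.subset ?_
    rintro _ ⟨t, ht, rfl⟩
    refine ⟨ht, ?_, ?_⟩ <;> norm_num
  refine hardy_infinite_zeros_on_critical_line_holds (himg.of_finite_image ?_)
  intro a _ b _ hab
  have := congrArg Complex.im hab
  simpa using this

/-- The crux with `0 < s.re` dropped. -/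
def CofiniteCriticalLineWithoutRePos : Prop :=
  {s : ℂ | riemannZeta s = 0 ∧ s.re < 1 ∧ s.re ≠ 1 / 2}.Finite

/-- FALSE without `0 < s.re`: the trivial zeros `-2(n+1)` (Mathlib `riemannZeta_neg_two_mul_nat_add_one`)
are infinitely many, off the line and left of `re s = 1`. -/
theorem cofiniteCriticalLine_false_without_rePos : ¬ CofiniteCriticalLineWithoutRePos := by
  intro hfin
  have hinj : Function.Injective (fun n : ℕ => (-2 * ((n : ℂ) + 1))) := by
    intro a b hab
    have h := congrArg Complex.re hab
    simp only [trivialZero_eq_ofReal, ofReal_re] at h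
    exact_mod_cast (by linarith : (a : ℝ) = b)
  refine (Set.infinite_range_of_injective hinj) (hfin.subset ?_)
  rintro _ ⟨n, rfl⟩
  have hn : (0 : ℝ) ≤ n := n.cast_nonneg
  refine ⟨riemannZeta_neg_two_mul_nat_add_one n, ?_, ?_⟩
  · show (-2 * ((n : ℂ) + 1)).re < 1
    rw [trivialZero_eq_ofReal, ofReal_re]; linarith
  · show (-2 * ((n : ℂ) + 1)).re ≠ 1 / 2
    rw [trivialZero_eq_ofReal, ofReal_re]; intro h; linarith

/-- The crux with `riemannZeta s = 0` dropped (sanity: the condition is of course load-bearing). -/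
def CofiniteCriticalLineWithoutZeta : Prop :=
  {s : ℂ | 0 < s.re ∧ s.re < 1 ∧ s.re ≠ 1 / 2}.Finite

/-- FALSE without `riemannZeta s = 0`: witnesses `1/4 + n i`. -/
theorem cofiniteCriticalLine_false_without_zeta : ¬ CofiniteCriticalLineWithoutZeta := by
  intro hfin
  have hinj : Function.Injective (fun n : ℕ => ((1 / 4 : ℝ) : ℂ) + (n : ℂ) * I) := by
    intro a b hab
    have h := congrArg Complex.im hab
    simp at h
    exact_mod_cast h
  refine (Set.infinite_range_of_injective hinj) (hfin.subset ?_)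
  rintro _ ⟨n, rfl⟩
  refine ⟨?_, ?_, ?_⟩ <;> norm_num

/-- The crux with `s.re < 1` dropped. -/
def CofiniteCriticalLineWithoutLtOne : Prop :=
  {s : ℂ | riemannZeta s = 0 ∧ 0 < s.re ∧ s.re ≠ 1 / 2}.Finite

/-- The set with `s.re < 1` dropped IS the exceptional set: `ζ` has no zeros on `re s ≥ 1`
(Hadamard–de la Vallée Poussin, Mathlib `riemannZeta_ne_zero_of_one_le_re`). -/
theorem setOf_withoutLtOne_eq_offLine :
    {s : ℂ | riemannZeta s = 0 ∧ 0 < s.re ∧ s.re ≠ 1 / 2} = offLine := by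
  ext s
  simp only [offLine, mem_setOf_eq]
  constructor
  · rintro ⟨hz, h0, hne⟩
    refine ⟨hz, h0, ?_, hne⟩
    by_contra h
    exact riemannZeta_ne_zero_of_one_le_re (not_lt.1 h) hz
  · rintro ⟨hz, h0, -, hne⟩
    exact ⟨hz, h0, hne⟩

/-- EQUIVALENT without `s.re < 1`: the conjunct is decoration for `ζ` ("possibly unnecessary
hypothesis" — information for the prover; but it encodes Euler-product input, see §4(c)). -/
theorem cofiniteCriticalLine_iff_without_ltOne : CofiniteCriticalLine ↔ CofiniteCriticalLineWithoutLtOne := by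
  rw [CofiniteCriticalLineWithoutLtOne, setOf_withoutLtOne_eq_offLine, cofiniteCriticalLine_iff]

/-! ## §3 Reformulations by the symmetries of the zero set -/

/-- Right half of the exceptional set (`FIN` of idea card zero-or-infinity-offline). -/
def rightHalf : Set ℂ := {s : ℂ | riemannZeta s = 0 ∧ 1 / 2 < s.re ∧ s.re < 1}

/-- Left half of the exceptional set. -/
def leftHalf : Set ℂ := {s : ℂ | riemannZeta s = 0 ∧ 0 < s.re ∧ s.re < 1 / 2}

theorem offLine_eq_leftHalf_union_rightHalf : offLine = leftHalf ∪ rightHalf := by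
  ext s
  simp only [offLine, leftHalf, rightHalf, mem_setOf_eq, mem_union]
  constructor
  · rintro ⟨hz, h0, h1, hne⟩
    rcases lt_or_gt_of_ne hne with h | h
    · exact Or.inl ⟨hz, h0, h⟩
    · exact Or.inr ⟨hz, h, h1⟩
  · rintro (⟨hz, h0, h⟩ | ⟨hz, h, h1⟩)
    · exact ⟨hz, h0, by linarith, h.ne⟩
    · exact ⟨hz, by linarith, h1, h.ne'⟩

/-- Zeros in the open strip are symmetric under `s ↦ 1 - s` (functional equation; tree lemma
`GeneralizedRH.riemannZeta_one_sub_eq_zero`, Mathlib `riemannZeta_one_sub` underneath). -/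
theorem one_sub_mem_rightHalf {s : ℂ} (hs : s ∈ leftHalf) : 1 - s ∈ rightHalf := by
  obtain ⟨hz, h0, h⟩ := hs
  refine ⟨GeneralizedRH.riemannZeta_one_sub_eq_zero hz h0 (by linarith), ?_, ?_⟩
  · simp only [sub_re, one_re]; linarith
  · simp only [sub_re, one_re]; linarith

theorem one_sub_mem_leftHalf {s : ℂ} (hs : s ∈ rightHalf) : 1 - s ∈ leftHalf := by
  obtain ⟨hz, h, h1⟩ := hs
  refine ⟨GeneralizedRH.riemannZeta_one_sub_eq_zero hz (by linarith) h1, ?_, ?_⟩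
  · simp only [sub_re, one_re]; linarith
  · simp only [sub_re, one_re]; linarith

theorem leftHalf_eq_image_rightHalf : leftHalf = (fun s : ℂ => 1 - s) '' rightHalf := by
  ext s
  constructor
  · intro hs
    exact ⟨1 - s, one_sub_mem_rightHalf hs, sub_sub_cancel 1 s⟩
  · rintro ⟨w, hw, rfl⟩
    exact one_sub_mem_leftHalf hw

theorem rightHalf_eq_image_leftHalf : rightHalf = (fun s : ℂ => 1 - s) '' leftHalf := by
  ext s
  constructor
  · intro hs
    exact ⟨1 - s, one_sub_mem_leftHalf hs, sub_sub_cancel 1 s⟩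
  · rintro ⟨w, hw, rfl⟩
    exact one_sub_mem_rightHalf hw

/-- Crux ⟺ finitely many zeros with `1/2 < re s < 1` (FIN). -/
theorem cofiniteCriticalLine_iff_rightHalf_finite : CofiniteCriticalLine ↔ rightHalf.Finite := by
  rw [cofiniteCriticalLine_iff, offLine_eq_leftHalf_union_rightHalf]
  refine ⟨fun h => h.subset subset_union_right, fun h => Set.Finite.union ?_ h⟩
  rw [leftHalf_eq_image_rightHalf]
  exact h.image _

/-- Crux ⟺ finitely many zeros with `0 < re s < 1/2`. -/
theorem cofiniteCriticalLine_iff_leftHalf_finite : CofiniteCriticalLine ↔ leftHalf.Finite := by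
  rw [cofiniteCriticalLine_iff, offLine_eq_leftHalf_union_rightHalf]
  refine ⟨fun h => h.subset subset_union_left, fun h => Set.Finite.union h ?_⟩
  rw [rightHalf_eq_image_leftHalf]
  exact h.image _

/-- The exceptional set is stable under complex conjugation (Mathlib `riemannZeta_conj`). -/
theorem conj_mem_offLine {s : ℂ} (hs : s ∈ offLine) : conj s ∈ offLine := by
  obtain ⟨hz, h0, h1, hne⟩ := hs
  exact ⟨by rw [riemannZeta_conj, hz, map_zero], by simpa using h0, by simpa using h1, by simpa using hne⟩

/-- Members of the exceptional set are non-real (`ζ(σ) ≠ 0` on `(0,1)`, `ZetaRealAxis`, proved). -/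
theorem im_ne_zero_of_mem_offLine {s : ℂ} (hs : s ∈ offLine) : s.im ≠ 0 :=
  im_ne_zero_of_riemannZeta_eq_zero hs.1 hs.2.1 hs.2.2.1

/-- Crux ⟺ finitely many exceptions in the upper half-plane. -/
theorem cofiniteCriticalLine_iff_upper_finite :
    CofiniteCriticalLine ↔ (offLine ∩ {s : ℂ | 0 < s.im}).Finite := by
  refine ⟨fun h => h.subset inter_subset_left, fun h => ?_⟩
  refine (h.union (h.image fun s : ℂ => conj s)).subset ?_
  intro s hs
  rcases lt_or_gt_of_ne (im_ne_zero_of_mem_offLine hs) with hneg | hpos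
  · refine Or.inr ⟨conj s, ⟨conj_mem_offLine hs, ?_⟩, ?_⟩
    · show 0 < (conj s).im
      rw [conj_im]; linarith
    · simp
  · exact Or.inl ⟨hs, hpos⟩

/-- The open quadrant part: zeros with `1/2 < re s < 1` and `0 < im s`. -/
def quadrant : Set ℂ := {s : ℂ | riemannZeta s = 0 ∧ 1 / 2 < s.re ∧ s.re < 1 ∧ 0 < s.im}

/-- Crux ⟺ finitely many zeros in the open quadrant `1/2 < re s < 1`, `im s > 0`
(both symmetries at once: `s ↦ 1 - conj s` and `s ↦ conj s`). -/
theorem cofiniteCriticalLine_iff_quadrant_finite : CofiniteCriticalLine ↔ quadrant.Finite := by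
  rw [cofiniteCriticalLine_iff_rightHalf_finite]
  refine ⟨fun h => h.subset ?_, fun h => ?_⟩
  · rintro s ⟨hz, h, h1, -⟩
    exact ⟨hz, h, h1⟩
  · refine (h.union (h.image fun s : ℂ => conj s)).subset ?_
    rintro s ⟨hz, h, h1⟩
    have him : s.im ≠ 0 := im_ne_zero_of_riemannZeta_eq_zero hz (by linarith) h1
    rcases lt_or_gt_of_ne him with hneg | hpos
    · refine Or.inr ⟨conj s, ⟨?_, ?_, ?_, ?_⟩, by simp⟩
      · rw [riemannZeta_conj, hz, map_zero]
      · simpa using h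
      · simpa using h1
      · rw [conj_im]; linarith
    · exact Or.inl ⟨hz, h, h1, hpos⟩

/-! ## §4 Natural strengthenings / abstractions refuted by small models -/

/-- (a) Rung #4's SHAPE does not imply rung #5's shape for an abstract set: `Z = {1/2 + 1/(n+2) + n i}`
has, for every `ε > 0`, only finitely many points with `|re s - 1/2| ≥ ε`, yet all its (infinitely many)
points are off the line. So `AsymptoticCriticalLine → CofiniteCriticalLine` needs arithmetic, not
bookkeeping (the converse `LadderGlue.2` is `Set.Finite.subset`). Symmetrising the witness under
`s ↦ 1 - conj s`, `s ↦ conj s` changes nothing. -/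
theorem not_abstract_asymptotic_imp_cofinite :
    ¬ ∀ Z : Set ℂ, (∀ ε : ℝ, 0 < ε → {s ∈ Z | ε ≤ |s.re - 1 / 2|}.Finite) →
      {s ∈ Z | s.re ≠ 1 / 2}.Finite := by
  intro h
  let f : ℕ → ℂ := fun n => ((1 / 2 + 1 / ((n : ℝ) + 2) : ℝ) : ℂ) + (n : ℂ) * I
  have hf_re : ∀ n, (f n).re = 1 / 2 + 1 / ((n : ℝ) + 2) := by
    intro n
    simp only [f, add_re, ofReal_re, mul_re, natCast_re, natCast_im, I_re, I_im, mul_zero, zero_mul,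
      sub_zero, add_zero]
  have hf_im : ∀ n, (f n).im = n := by
    intro n
    simp only [f, add_im, ofReal_im, mul_im, natCast_re, natCast_im, I_re, I_im, mul_one, mul_zero,
      add_zero, zero_add]
  have hf : Function.Injective f := by
    intro a b hab
    have := congrArg Complex.im hab
    rw [hf_im, hf_im] at this
    exact_mod_cast this
  have hpos : ∀ n : ℕ, (0 : ℝ) < 1 / ((n : ℝ) + 2) := fun n => by positivity
  have hband : ∀ ε : ℝ, 0 < ε → {s ∈ Set.range f | ε ≤ |s.re - 1 / 2|}.Finite := by
    intro ε hε
    refine ((Set.finite_Iic ⌈1 / ε⌉₊).image f).subset ?_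
    rintro s ⟨⟨n, rfl⟩, hs⟩
    refine ⟨n, ?_, rfl⟩
    rw [hf_re, add_sub_cancel_left, abs_of_pos (hpos n)] at hs
    show n ≤ ⌈1 / ε⌉₊
    have hn2 : (0 : ℝ) < (n : ℝ) + 2 := by positivity
    have h1 : ε * ((n : ℝ) + 2) ≤ 1 := by
      have := (le_div_iff₀ hn2).1 hs
      linarith
    have h2 : (n : ℝ) + 2 ≤ 1 / ε := by
      rw [le_div_iff₀ hε]; linarith
    have h3 : (n : ℝ) ≤ ⌈1 / ε⌉₊ := by linarith [Nat.le_ceil (1 / ε)]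
    exact_mod_cast h3
  have hfin := h (Set.range f) hband
  refine (Set.infinite_range_of_injective hf) (hfin.subset ?_)
  rintro s ⟨n, rfl⟩
  refine ⟨⟨n, rfl⟩, ?_⟩
  show (f n).re ≠ 1 / 2
  rw [hf_re]
  exact ne_of_gt (by linarith [hpos n])

/-- (b) Rung #5's shape does not imply X's shape (`ExactFirstBand`: on the line or real) for an abstract
set: one non-real off-line point. The step X ⇐ rung #5 ("exceptional first-band resonances are real")
is genuine input (for `ζ` it then closes by `ζ(σ) ≠ 0` on `(0,1)`). -/
theorem not_abstract_cofinite_imp_exact :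
    ¬ ∀ Z : Set ℂ, {s ∈ Z | s.re ≠ 1 / 2}.Finite → ∀ s ∈ Z, s.re = 1 / 2 ∨ s.im = 0 := by
  intro h
  have hZ : {s ∈ ({((3 / 4 : ℝ) : ℂ) + I} : Set ℂ) | s.re ≠ 1 / 2}.Finite :=
    (Set.finite_singleton _).subset (Set.sep_subset _ _)
  have := h {((3 / 4 : ℝ) : ℂ) + I} hZ (((3 / 4 : ℝ) : ℂ) + I) rfl
  norm_num at this

open Literature.Barriers.RiemannHypothesis in
/-- (c) BARRIER (functional-equation-only class): the crux in its `ζ`-equivalent form of §2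
(`s.re < 1` dropped) FAILS for the Davenport–Heilbronn function `f` (Dirichlet series with a degree-one
Riemann-type functional equation, no Euler product): `f` has infinitely many zeros in `re s > 1`
(Davenport–Heilbronn 1936; Titchmarsh §10.25; PROVED in tree: `DavenportHeilbronn_holds`). Any proof of the
crux must use a property of `ζ` that `f` lacks — already to get the (for `ζ` redundant) confinement
`re s < 1`. -/
theorem not_cofinite_shape_davenportHeilbronn :
    ¬ {s : ℂ | davenportHeilbronn s = 0 ∧ 0 < s.re ∧ s.re ≠ 1 / 2}.Finite := by
  intro hfin
  refine DavenportHeilbronn_holds (hfin.subset ?_)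
  rintro s ⟨h1, hz⟩
  exact ⟨hz, by linarith, fun h => by rw [h] at h1; norm_num at h1⟩

/-! ## §5 Ladder position (copies for the provers; the crux sits strictly between #4 and X) -/

/-- `X → rung #5`: under `ExactFirstBand` every exception would be real, and there is none. -/
theorem cofiniteCriticalLine_of_exactFirstBand (hX : ExactFirstBand) : CofiniteCriticalLine := by
  rw [cofiniteCriticalLine_iff]
  convert Set.finite_empty
  refine Set.subset_empty_iff.1 fun s hs => ?_
  obtain ⟨hz, h0, h1, hne⟩ := hs
  rcases hX s hz h0 h1 with h | him
  · exact hne h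
  · exact im_ne_zero_of_riemannZeta_eq_zero hz h0 h1 him

/-- `rung #5 → rung #4`: `Set.Finite.subset`. -/
theorem asymptoticCriticalLine_of_cofiniteCriticalLine (h : CofiniteCriticalLine) :
    AsymptoticCriticalLine := by
  intro ε hε
  refine h.subset ?_
  rintro s ⟨hz, h0, h1, hε'⟩
  refine ⟨hz, h0, h1, fun he => ?_⟩
  rw [he, sub_self, abs_zero] at hε'
  linarith

/-- `RH → X`. -/
theorem exactFirstBand_of_riemannHypothesis (h : RiemannHypothesis) : ExactFirstBand :=
  fun s hz h0 h1 => Or.inl (h s hz (not_trivial_of_re_pos h0) (by rintro rfl; norm_num at h1))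

/-! ## §6 The crux is the endpoint `t = 0` of the Ki–Kim–Lee theorem (de Bruijn–Newman deformation) -/

section KiKimLee

open Filter Metric Topology

/-- Real part of the de Bruijn substitution `s = 1/2 + iz/2`. -/
theorem re_deBruijnSubst (z : ℂ) : (1 / 2 + I * z / 2 : ℂ).re = (1 - z.im) / 2 := by
  simp only [add_re, div_ofNat_re, one_re, mul_re, I_re, I_im, zero_mul, one_mul, zero_sub]
  ring

/-- Imaginary part of the de Bruijn substitution `s = 1/2 + iz/2`. -/
theorem im_deBruijnSubst (z : ℂ) : (1 / 2 + I * z / 2 : ℂ).im = z.re / 2 := by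
  simp only [add_im, div_ofNat_im, one_im, mul_im, I_re, I_im, zero_mul, one_mul, zero_add, zero_div]

/-- Zeros of `H_0` ↔ zeros of `ζ` in the open strip under `s = 1/2 + iz/2` (`deBruijnH_zero_eq_holds`,
`riemannXi_eq_zero_iff_holds`, both proved in tree). -/
theorem deBruijnH_zero_eq_zero_iff' (z : ℂ) :
    deBruijnH 0 z = 0 ↔
      riemannZeta (1 / 2 + I * z / 2) = 0 ∧ 0 < (1 - z.im) / 2 ∧ (1 - z.im) / 2 < 1 := by
  rw [deBruijnH_zero_eq_holds z, div_eq_zero_iff, or_iff_left (by norm_num), riemannXi_eq_zero_iff_holds,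
    re_deBruijnSubst]

/-- **The crux is Ki–Kim–Lee at `t = 0`**: `CofiniteCriticalLine ↔ ∃ T, ∀ z, H_0 z = 0 → T ≤ |Re z| → Im z = 0`,
verbatim the conclusion of `ki_kim_lee_finite` (Ki–Kim–Lee 2009 Thm 1.3, for every `t > 0`) at `t = 0`. -/
theorem cofiniteCriticalLine_iff_kiKimLee_at_zero :
    CofiniteCriticalLine ↔ ∃ T : ℝ, ∀ z : ℂ, deBruijnH 0 z = 0 → T ≤ |z.re| → z.im = 0 := by
  constructor
  · intro h
    obtain ⟨T, hT⟩ := (Set.Finite.image (fun s : ℂ => |s.im|) h).bddAbove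
    refine ⟨2 * |T| + 1, fun z hz hre => ?_⟩
    obtain ⟨hζ, h0, h1⟩ := (deBruijnH_zero_eq_zero_iff' z).1 hz
    by_contra him
    have hmem : (1 / 2 + I * z / 2 : ℂ) ∈ offLine := by
      refine ⟨hζ, ?_, ?_, ?_⟩
      · rw [re_deBruijnSubst]; exact h0
      · rw [re_deBruijnSubst]; exact h1
      · rw [re_deBruijnSubst]; intro h'; apply him; linarith
    have hle : |(1 / 2 + I * z / 2 : ℂ).im| ≤ T := hT ⟨_, hmem, rfl⟩
    rw [im_deBruijnSubst, abs_div, abs_two] at hle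
    linarith [le_abs_self T, abs_nonneg z.re]
  · rintro ⟨T, hT⟩
    refine (((isCompact_Icc (a := (0 : ℝ)) (b := 1)).reProdIm
      (isCompact_Icc (a := -|T|) (b := |T|))).inter_riemannZetaZeros_finite).subset ?_
    rintro s ⟨hζ, h0, h1, hne⟩
    refine ⟨Complex.mem_reProdIm.2 ⟨⟨h0.le, h1.le⟩, abs_le.1 ?_⟩, hζ⟩
    refine le_of_not_gt fun hlt => ?_
    set z : ℂ := ((2 * s.im : ℝ) : ℂ) + ((1 - 2 * s.re : ℝ) : ℂ) * I with hz
    have hzre : z.re = 2 * s.im := by simp [hz]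
    have hzim : z.im = 1 - 2 * s.re := by simp [hz]
    have hs : (1 / 2 + I * z / 2 : ℂ) = s := by
      apply Complex.ext
      · rw [re_deBruijnSubst, hzim]; ring
      · rw [im_deBruijnSubst, hzre]; ring
    have hz0 : deBruijnH 0 z = 0 := by
      rw [deBruijnH_zero_eq_zero_iff', hs, hzim]
      exact ⟨hζ, by linarith, by linarith⟩
    have hreal := hT z hz0 (by rw [hzre, abs_mul, abs_two]; linarith [le_abs_self T, abs_nonneg s.im])
    rw [hzim] at hreal
    apply hne
    linarith

/-- Ki–Kim–Lee on the CLOSED half-line `t ≥ 0` ⟺ Ki–Kim–Lee (named fact, `t > 0`) ∧ crux. -/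
theorem kiKimLee_closed_iff :
    (∀ t : ℝ, 0 ≤ t → ∃ T : ℝ, ∀ z : ℂ, deBruijnH t z = 0 → T ≤ |z.re| → z.im = 0) ↔
      ki_kim_lee_finite ∧ CofiniteCriticalLine := by
  rw [cofiniteCriticalLine_iff_kiKimLee_at_zero]
  refine ⟨fun h => ⟨fun t ht => h t ht.le, h 0 le_rfl⟩, fun h t ht => ?_⟩
  rcases ht.eq_or_lt with rfl | hpos
  · exact h.2
  · exact h.1 t hpos

/-- `(t, z) ↦ H_t(z)` is jointly continuous (`continuous_cosMoment_uncurry 0`). -/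
theorem continuous_deBruijnH_uncurry : Continuous fun p : ℝ × ℂ => deBruijnH p.1 p.2 := by
  have h := continuous_cosMoment_uncurry 0
  simp_rw [cosMoment_zero] at h
  exact h

/-- `H_t → H_{t₀}` uniformly on closed balls as `t → t₀`. -/
theorem tendstoUniformlyOn_deBruijnH (t₀ : ℝ) (z₀ : ℂ) (r : ℝ) :
    TendstoUniformlyOn (fun t : ℝ => deBruijnH t) (deBruijnH t₀) (𝓝 t₀) (closedBall z₀ r) := by
  rw [tendstoUniformlyOn_iff_tendstoUniformly_comp_coe]
  have hc : Continuous fun p : ℝ × (closedBall z₀ r) => deBruijnH p.1 (p.2 : ℂ) :=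
    continuous_deBruijnH_uncurry.comp (continuous_fst.prodMk (continuous_subtype_val.comp continuous_snd))
  exact Continuous.tendstoUniformly (fun (t : ℝ) (w : closedBall z₀ r) => deBruijnH t (w : ℂ)) hc t₀

/-- Zeros of `H_{t₀}` are isolated (`H_{t₀}` entire, `H_{t₀}(0) ≠ 0`). -/
theorem eventually_ne_zero_deBruijnH (t₀ : ℝ) (z₀ : ℂ) : ∀ᶠ z in 𝓝[≠] z₀, deBruijnH t₀ z ≠ 0 := by
  have hdiff : Differentiable ℂ (deBruijnH t₀) := differentiable_deBruijnH_holds t₀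
  rcases (hdiff.analyticAt z₀).eventually_eq_zero_or_eventually_ne_zero with hev | hev
  · exfalso
    have hEq : EqOn (deBruijnH t₀) 0 univ :=
      (hdiff.differentiableOn.analyticOnNhd isOpen_univ).eqOn_zero_of_preconnected_of_eventuallyEq_zero
        isPreconnected_univ (mem_univ z₀) hev
    exact deBruijnH_apply_zero_ne_zero t₀ (hEq (mem_univ 0))
  · exact hev

/-- HURWITZ STEP: one Ki–Kim–Lee threshold `T` for all `t ∈ (0, δ)` gives the threshold `T + 1` at `t = 0`. -/
theorem kiKimLee_at_zero_of_uniform {T δ : ℝ} (hδ : 0 < δ)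
    (h : ∀ t : ℝ, 0 < t → t < δ → ∀ z : ℂ, deBruijnH t z = 0 → T ≤ |z.re| → z.im = 0) :
    ∀ z : ℂ, deBruijnH 0 z = 0 → T + 1 ≤ |z.re| → z.im = 0 := by
  intro z₀ hz₀ hre
  by_contra him
  have hdiff : ∀ t, Differentiable ℂ (deBruijnH t) := differentiable_deBruijnH_holds
  obtain ⟨r₁, hr₁, hball⟩ :=
    Metric.eventually_nhds_iff_ball.1 (eventually_nhdsWithin_iff.1 (eventually_ne_zero_deBruijnH 0 z₀))
  have him0 : 0 < |z₀.im| := abs_pos.2 him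
  set r : ℝ := min (r₁ / 2) (min (1 / 2) (|z₀.im| / 2)) with hr_def
  have hr : 0 < r := by
    simp only [hr_def, lt_min_iff]
    exact ⟨by linarith, by norm_num, by linarith⟩
  have hr₁' : r < r₁ := lt_of_le_of_lt (min_le_left _ _) (by linarith)
  have hrhalf : r ≤ 1 / 2 := le_trans (min_le_right _ _) (min_le_left _ _)
  have hrim : r ≤ |z₀.im| / 2 := le_trans (min_le_right _ _) (min_le_right _ _)
  have hunif : TendstoUniformlyOn (fun t : ℝ => deBruijnH t) (deBruijnH 0) (𝓝[>] (0 : ℝ))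
      (closedBall z₀ r) :=
    fun u hu => nhdsWithin_le_nhds ((tendstoUniformlyOn_deBruijnH 0 z₀ r) u hu)
  have hF : ∀ᶠ t in 𝓝[>] (0 : ℝ), DiffContOnCl ℂ (deBruijnH t) (ball z₀ r) :=
    Filter.Eventually.of_forall fun t => (hdiff t).diffContOnCl
  have hsphere : ∀ z ∈ sphere z₀ r, deBruijnH 0 z ≠ 0 := by
    intro z hz
    refine hball z (sphere_subset_closedBall.trans (closedBall_subset_ball hr₁') hz) ?_
    rw [mem_compl_singleton_iff]
    intro hzz
    have : dist z z₀ = r := mem_sphere.1 hz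
    rw [hzz, dist_self] at this
    exact hr.ne this
  have hcont : ContinuousOn (deBruijnH 0) (sphere z₀ r) := (hdiff 0).continuous.continuousOn
  have hev2 := Complex.eventually_exists_zero_mem_ball_of_tendstoUniformlyOn hr hF hunif hcont hz₀ hsphere
  have hev3 : ∀ᶠ t in 𝓝[>] (0 : ℝ), t ∈ Ioo 0 δ := Ioo_mem_nhdsGT hδ
  obtain ⟨t, ⟨ht0, htδ⟩, zt, hzt, hzt0⟩ := (hev3.and hev2).exists
  have hd : ‖zt - z₀‖ < r := by rwa [mem_ball, dist_eq_norm] at hzt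
  have hre_t : T ≤ |zt.re| := by
    have h1 : |zt.re - z₀.re| < r := lt_of_le_of_lt (by simpa using abs_re_le_norm (zt - z₀)) hd
    have h2 := abs_sub_abs_le_abs_sub z₀.re zt.re
    rw [abs_sub_comm] at h2
    linarith
  have him_t := h t ht0 htδ zt hzt0 hre_t
  have h3 : |zt.im - z₀.im| < r := lt_of_le_of_lt (by simpa using abs_im_le_norm (zt - z₀)) hd
  rw [him_t, zero_sub, abs_neg] at h3
  linarith

/-- A uniform Ki–Kim–Lee threshold near `t = 0⁺` PROVES the crux (sufficient condition for the provers). -/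
theorem cofiniteCriticalLine_of_uniform_kiKimLee {T δ : ℝ} (hδ : 0 < δ)
    (h : ∀ t : ℝ, 0 < t → t < δ → ∀ z : ℂ, deBruijnH t z = 0 → T ≤ |z.re| → z.im = 0) :
    CofiniteCriticalLine :=
  cofiniteCriticalLine_iff_kiKimLee_at_zero.2 ⟨T + 1, kiKimLee_at_zero_of_uniform hδ h⟩

/-- THE DISPROVER'S READING: a kill of the crux forces, for every `T` and `δ > 0`, a NON-REAL zero of some
`H_t`, `0 < t < δ`, with `|Re z| ≥ T` — the Ki–Kim–Lee thresholds `T(t)` are unbounded as `t → 0⁺`. -/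
theorem kiKimLee_thresholds_unbounded_of_not_cofinite (hno : ¬ CofiniteCriticalLine) (T δ : ℝ)
    (hδ : 0 < δ) : ∃ t : ℝ, 0 < t ∧ t < δ ∧ ∃ z : ℂ, deBruijnH t z = 0 ∧ T ≤ |z.re| ∧ z.im ≠ 0 := by
  by_contra hcon
  apply hno
  refine cofiniteCriticalLine_of_uniform_kiKimLee (T := T) hδ fun t ht0 htδ z hz hT => ?_
  by_contra him
  exact hcon ⟨t, ht0, htδ, z, hz, hT, him⟩

end KiKimLee

/-! ## §7 (cycle 2) The crux is cofinite Lagarias positivity / cofinite Sondow–Dumitrescu monotonicity;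
the collar half of idea `rate-band-collar-split` is zero-location in costume

(Landed copies: `Theorems/CofiniteCriticalLine/Negative/HorizontalMonotonicity.lean` (p76385) and
`…/Negative/CollarCostume.lean` (p77656), namespace `Summit.RiemannHypothesis.Cruxes.CofiniteCriticalLine.Negative`;
import those rather than this workfile.) -/

section HorizontalMonotonicity

open Filter Topology

/-! ### The non-trivial zeros as a subtype, and the reflection `ρ ↦ 1 − ρ̄` -/

/-- Membership in the tree's set of non-trivial zeros (`RHWave0.riemannZetaNontrivialZeros`) is
`ζ ρ = 0 ∧ 0 < re ρ < 1` (tree: `mem_riemannZetaNontrivialZeros_iff_holds`). [folklore] -/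
theorem mem_nontrivialZeros_iff {ρ : ℂ} :
    ρ ∈ RHWave0.riemannZetaNontrivialZeros ↔ riemannZeta ρ = 0 ∧ 0 < ρ.re ∧ ρ.re < 1 :=
  mem_riemannZetaNontrivialZeros_iff_holds

/-- The zero set of `ζ` in the strip is stable under `ρ ↦ 1 − ρ̄` (conjugation `riemannZeta_conj` and the
functional equation, tree lemma `GeneralizedRH.riemannZeta_one_sub_eq_zero`). [folklore] -/
theorem one_sub_conj_mem_nontrivialZeros {ρ : ℂ} (hρ : ρ ∈ RHWave0.riemannZetaNontrivialZeros) :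
    1 - conj ρ ∈ RHWave0.riemannZetaNontrivialZeros := by
  rw [mem_nontrivialZeros_iff] at hρ ⊢
  obtain ⟨hz, h0, h1⟩ := hρ
  have hzc : riemannZeta (conj ρ) = 0 := by rw [riemannZeta_conj, hz, map_zero]
  refine ⟨GeneralizedRH.riemannZeta_one_sub_eq_zero hzc (by simpa using h0) (by simpa using h1), ?_, ?_⟩
  · simp only [sub_re, one_re, conj_re]; linarith
  · simp only [sub_re, one_re, conj_re]; linarith

/-- The multiplicity is invariant under `ρ ↦ 1 − ρ̄` (tree: `riemannZetaZeroOrder_conj_holds`,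
`riemannZetaZeroOrder_one_sub_holds`). [folklore] -/
theorem zeroOrder_one_sub_conj (ρ : RHWave0.riemannZetaNontrivialZeros) :
    riemannZetaZeroOrder (1 - conj (ρ : ℂ)) = riemannZetaZeroOrder (ρ : ℂ) := by
  obtain ⟨-, h0, h1⟩ := mem_nontrivialZeros_iff.1 ρ.2
  rw [riemannZetaZeroOrder_one_sub_holds (by simpa using h0) (by simpa using h1)]
  exact riemannZetaZeroOrder_conj_holds ρ

/-- Every non-trivial zero has positive multiplicity. [folklore] -/
theorem zeroOrder_pos (ρ : RHWave0.riemannZetaNontrivialZeros) : 0 < riemannZetaZeroOrder (ρ : ℂ) := by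
  obtain ⟨hz, -, h1⟩ := mem_nontrivialZeros_iff.1 ρ.2
  refine (riemannZetaZeroOrder_pos_iff ?_).2 hz
  intro h; rw [h] at h1; norm_num at h1

/-- There is a non-trivial zero (Hardy's theorem, proved in tree, gives infinitely many on the line).
[folklore] -/
theorem nonempty_nontrivialZeros : Nonempty RHWave0.riemannZetaNontrivialZeros := by
  obtain ⟨t, ht⟩ := hardy_infinite_zeros_on_critical_line_holds.nonempty
  refine ⟨⟨1 / 2 + t * I, mem_nontrivialZeros_iff.2 ⟨ht, ?_, ?_⟩⟩⟩ <;> norm_num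

/-- Bookkeeping: if no zero with `1/2 < re s < 1` has height `≥ T`, the crux holds (reflect the left half
by `s ↦ 1 − s`, tree lemma `GeneralizedRH.riemannZeta_one_sub_eq_zero`; zeros of bounded height are finitely
many, Mathlib `IsCompact.inter_riemannZetaZeros_finite`). [folklore] -/
theorem cofinite_of_no_rightHalf_zero_above {T : ℝ}
    (key : ∀ s : ℂ, riemannZeta s = 0 → 1 / 2 < s.re → s.re < 1 → T ≤ |s.im| → False) :
    CofiniteCriticalLine := by
  refine (((isCompact_Icc (a := (0 : ℝ)) (b := 1)).reProdIm
    (isCompact_Icc (a := -T) (b := T))).inter_riemannZetaZeros_finite).subset ?_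
  rintro s ⟨hz, h0, h1, hne⟩
  refine ⟨Complex.mem_reProdIm.2 ⟨⟨h0.le, h1.le⟩, abs_le.1 (le_of_not_gt fun hT => ?_)⟩, hz⟩
  rcases lt_or_gt_of_ne hne with hlt | hgt
  · refine key (1 - s) (GeneralizedRH.riemannZeta_one_sub_eq_zero hz h0 h1) ?_ ?_ ?_
    · simp only [sub_re, one_re]; linarith
    · simp only [sub_re, one_re]; linarith
    · simp only [sub_im, one_im, zero_sub, abs_neg]; exact hT.le
  · exact key s hz hgt h1 hT.le

/-! ### The Matiyasevich–Saidak–Zvengrowski pair computation -/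

/-- MSZ pair lemma: for `x > 0` and `a² < x² + u²`,
`(x − a)/((x − a)² + u²) + (x + a)/((x + a)² + u²) > 0` (it equals `2x(x² − a² + u²)/D`). [folklore] -/
theorem msz_pair_pos {x a u : ℝ} (hx : 0 < x) (h : a ^ 2 < x ^ 2 + u ^ 2) :
    0 < (x - a) / ((x - a) ^ 2 + u ^ 2) + (x + a) / ((x + a) ^ 2 + u ^ 2) := by
  have hP : 0 < (x - a) ^ 2 + u ^ 2 := by
    by_contra hP
    have h1 : (x - a) ^ 2 + u ^ 2 = 0 := le_antisymm (not_lt.1 hP) (by positivity)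
    have hxa : x - a = 0 := by nlinarith [sq_nonneg (x - a), sq_nonneg u]
    have hu : u = 0 := by nlinarith [sq_nonneg (x - a), sq_nonneg u]
    have : a = x := by linarith
    rw [this, hu] at h; simp at h
  have hQ : 0 < (x + a) ^ 2 + u ^ 2 := by
    by_contra hQ
    have h1 : (x + a) ^ 2 + u ^ 2 = 0 := le_antisymm (not_lt.1 hQ) (by positivity)
    have hxa : x + a = 0 := by nlinarith [sq_nonneg (x + a), sq_nonneg u]
    have hu : u = 0 := by nlinarith [sq_nonneg (x + a), sq_nonneg u]
    have : a = -x := by linarith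
    rw [this, hu] at h; simp at h
  rw [div_add_div _ _ hP.ne' hQ.ne']
  refine div_pos ?_ (mul_pos hP hQ)
  have hid : (x - a) * ((x + a) ^ 2 + u ^ 2) + ((x - a) ^ 2 + u ^ 2) * (x + a) =
      2 * x * (x ^ 2 - a ^ 2 + u ^ 2) := by ring
  rw [hid]
  have : 0 < x ^ 2 - a ^ 2 + u ^ 2 := by linarith
  positivity

/-- The pair lemma in zero coordinates: `σ > 1/2`, `(β − 1/2)² < (σ − 1/2)² + (t − γ)²` give
`(σ − β)/|s − ρ|² + (σ − (1 − β))/|s − (1 − ρ̄)|² > 0` (`ρ = β + iγ`, `1 − ρ̄ = (1 − β) + iγ`). [folklore] -/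
theorem msz_pair_pos' {σ β t γ : ℝ} (hσ : 1 / 2 < σ) (h : (β - 1 / 2) ^ 2 < (σ - 1 / 2) ^ 2 + (t - γ) ^ 2) :
    0 < (σ - β) / ((σ - β) ^ 2 + (t - γ) ^ 2) + (σ - (1 - β)) / ((σ - (1 - β)) ^ 2 + (t - γ) ^ 2) := by
  have h' := msz_pair_pos (x := σ - 1 / 2) (a := β - 1 / 2) (u := t - γ) (by linarith) h
  have e1 : σ - 1 / 2 - (β - 1 / 2) = σ - β := by ring
  have e2 : σ - 1 / 2 + (β - 1 / 2) = σ - (1 - β) := by ring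
  rw [e1, e2] at h'
  exact h'

/-- `Re 1/(s − ρ) = (σ − β)/((σ − β)² + (t − γ)²)`. [folklore] -/
theorem re_inv_sub_eq' (s ρ : ℂ) :
    (1 / (s - ρ)).re = (s.re - ρ.re) / ((s.re - ρ.re) ^ 2 + (s.im - ρ.im) ^ 2) := by
  rw [IsHadamardSeq.re_inv_sub_eq, Complex.sq_norm, Complex.normSq_apply]
  simp only [sub_re, sub_im]
  ring

/-! ### Pointwise MSZ criterion for `Re ξ'/ξ > 0` -/

/-- **Pointwise symmetrised Sondow–Dumitrescu / Lagarias criterion.** Let `re s > 1/2` and suppose every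
OFF-LINE zero `ρ = β + iγ` of `ζ` satisfies `(β − 1/2)² < (σ − 1/2)² + (t − γ)²` (i.e. `s` lies outside
the closed disc centred at `1/2 + iγ` of radius `|β − 1/2| < 1/2`). Then `Re ξ'/ξ(s) > 0`.
Proof: `Re ξ'/ξ(s) = Σ_ρ m(ρ) Re 1/(s − ρ)` (tree, `hasSum_zeroOrder_mul_re_inv_sub`); symmetrise over
`ρ ↦ 1 − ρ̄` (same multiplicity) and apply the pair lemma. The unsymmetrised argument (`σ >` every `Re ρ`
⟹ every term positive) is Sondow–Dumitrescu's Thm 1 as re-proved by Matiyasevich–Saidak–Zvengrowski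
(Thm 1.1 via Lemmas 2.1/2.3) and Lagarias (1.4)–(1.5); the pairing sharpens it: the hypothesis is void under RH,
for `re s ≥ 1`, and at every height `t` at distance `≥ 1/2` from the ordinates of all off-line zeros.
[cite: SondowDumitrescu2010, Thm 1] [cite: MatiyasevichSaidakZvengrowski2014, Thm 1.1 and Lemma 2.3] -/
theorem re_logDeriv_riemannXi_pos_of_offLine {s : ℂ} (hs : 1 / 2 < s.re)
    (hfar : ∀ ρ : ℂ, riemannZeta ρ = 0 → 0 < ρ.re → ρ.re < 1 → ρ.re ≠ 1 / 2 →
      (ρ.re - 1 / 2) ^ 2 < (s.re - 1 / 2) ^ 2 + (s.im - ρ.im) ^ 2) :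
    0 < (logDeriv riemannXi s).re := by
  -- the hypothesis holds for ALL non-trivial zeros (on-line ones: `0 < (σ - 1/2)²`)
  have hall : ∀ ρ : ℂ, riemannZeta ρ = 0 → 0 < ρ.re → ρ.re < 1 →
      (ρ.re - 1 / 2) ^ 2 < (s.re - 1 / 2) ^ 2 + (s.im - ρ.im) ^ 2 := by
    intro ρ hz h0 h1
    by_cases hne : ρ.re = 1 / 2
    · have h2 : (0 : ℝ) < (s.re - 1 / 2) ^ 2 := pow_pos (by linarith) 2
      rw [hne]
      nlinarith [sq_nonneg (s.im - ρ.im)]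
    · exact hfar ρ hz h0 h1 hne
  -- `s` is not a zero of `ζ`
  have hζ : riemannZeta s ≠ 0 := by
    intro hz
    by_cases h1 : s.re < 1
    · have := hall s hz (by linarith) h1
      simp at this
    · exact riemannZeta_ne_zero_of_one_le_re (not_lt.1 h1) hz
  have hsum := hasSum_zeroOrder_mul_re_inv_sub hζ
  -- the reflection `ρ ↦ 1 - conj ρ` as a permutation (involution) of the non-trivial zeros
  let φ : Equiv.Perm RHWave0.riemannZetaNontrivialZeros :=
    Function.Involutive.toPerm (fun ρ => ⟨1 - conj (ρ : ℂ), one_sub_conj_mem_nontrivialZeros ρ.2⟩)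
      (fun ρ => Subtype.ext (by simp))
  have hφ : ∀ ρ : RHWave0.riemannZetaNontrivialZeros,
      ((φ ρ : RHWave0.riemannZetaNontrivialZeros) : ℂ) = 1 - conj (ρ : ℂ) := fun ρ => rfl
  set f : RHWave0.riemannZetaNontrivialZeros → ℝ :=
    fun ρ => (riemannZetaZeroOrder (ρ : ℂ) : ℝ) * (1 / (s - ρ)).re with hf
  have hsum' : HasSum (f ∘ φ) (logDeriv riemannXi s).re := (Equiv.hasSum_iff φ).2 hsum
  have hg : HasSum (fun ρ => f ρ + f (φ ρ)) ((logDeriv riemannXi s).re + (logDeriv riemannXi s).re) :=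
    hsum.add hsum'
  -- every symmetrised term is positive
  have hpos : ∀ ρ : RHWave0.riemannZetaNontrivialZeros, 0 < f ρ + f (φ ρ) := by
    intro ρ
    obtain ⟨hz, h0, h1⟩ := mem_nontrivialZeros_iff.1 ρ.2
    have hm : (0 : ℝ) < riemannZetaZeroOrder (ρ : ℂ) := by exact_mod_cast zeroOrder_pos ρ
    have hkey := hall ρ hz h0 h1
    simp only [hf]
    rw [hφ, zeroOrder_one_sub_conj, re_inv_sub_eq', re_inv_sub_eq', ← mul_add]
    refine mul_pos hm ?_
    simp only [sub_re, one_re, conj_re, sub_im, one_im, conj_im, zero_sub, neg_neg]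
    exact msz_pair_pos' hs hkey
  obtain ⟨ρ₀⟩ := nonempty_nontrivialZeros
  have htsum : 0 < ∑' ρ, (f ρ + f (φ ρ)) :=
    hg.summable.tsum_pos (fun ρ => (hpos ρ).le) ρ₀ (hpos ρ₀)
  rw [hg.tsum_eq] at htsum
  linarith

/-- Off-line zeros at heights far from `t` do not obstruct: if every off-line zero `ρ` has
`|t − Im ρ| ≥ 1/2` then `Re ξ'/ξ(σ + it) > 0` for every `σ > 1/2`. [folklore] -/
theorem re_logDeriv_riemannXi_pos_of_offLine_height {σ t : ℝ} (hσ : 1 / 2 < σ)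
    (hfar : ∀ ρ : ℂ, riemannZeta ρ = 0 → 0 < ρ.re → ρ.re < 1 → ρ.re ≠ 1 / 2 → 1 / 2 ≤ |t - ρ.im|) :
    0 < (logDeriv riemannXi (σ + t * I)).re := by
  refine re_logDeriv_riemannXi_pos_of_offLine (by simpa using hσ) fun ρ hz h0 h1 hne => ?_
  have hu := hfar ρ hz h0 h1 hne
  have hβ : (ρ.re - 1 / 2) ^ 2 < (1 / 2) ^ 2 := by nlinarith
  have hσ' : 0 < ((σ : ℂ) + t * I).re - 1 / 2 := by simp; linarith
  have him : ((σ : ℂ) + t * I).im = t := by simp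
  rw [him]
  have h14 : (1 / 2 : ℝ) ^ 2 ≤ (t - ρ.im) ^ 2 := by
    calc (1 / 2 : ℝ) ^ 2 ≤ |t - ρ.im| ^ 2 := by gcongr
      _ = (t - ρ.im) ^ 2 := sq_abs _
  nlinarith

/-- **Lagarias (1.4), unconditionally and on the closed half-plane**: `Re ξ'/ξ(s) > 0` for `re s ≥ 1`
(every off-line zero has `|β − 1/2| < 1/2 ≤ σ − 1/2`). [cite: LagariasXiPositivity1999, eq. (1.4)] -/
theorem re_logDeriv_riemannXi_pos_of_one_le_re {s : ℂ} (hs : 1 ≤ s.re) : 0 < (logDeriv riemannXi s).re := by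
  refine re_logDeriv_riemannXi_pos_of_offLine (by linarith) fun ρ _ h0 h1 _ => ?_
  have hβ : (ρ.re - 1 / 2) ^ 2 < (1 / 2) ^ 2 := by nlinarith
  have : (1 / 2 : ℝ) ^ 2 ≤ (s.re - 1 / 2) ^ 2 := by nlinarith
  nlinarith [sq_nonneg (s.im - ρ.im)]

/-! ### From positivity of `Re ξ'/ξ` to horizontal monotonicity of `|ξ|` -/

/-- If `Re ξ'/ξ(σ + it) > 0` for all `σ > 1/2` (at a fixed height `t`), then `σ ↦ |ξ(σ + it)|` is strictly
increasing on `[1/2, ∞)`. (Mathlib's `logDeriv` is `0` at a zero, so the hypothesis includes `ξ ≠ 0` on the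
open ray; the endpoint is handled by continuity.) [folklore] -/
theorem strictMonoOn_norm_riemannXi_of_re_logDeriv_pos {t : ℝ}
    (h : ∀ σ : ℝ, 1 / 2 < σ → 0 < (logDeriv riemannXi (σ + t * I)).re) :
    StrictMonoOn (fun σ : ℝ => ‖riemannXi (σ + t * I)‖) (Ici (1 / 2)) := by
  have hne : ∀ σ : ℝ, 1 / 2 < σ → riemannXi (σ + t * I) ≠ 0 := by
    intro σ hσ h0
    have := h σ hσ
    rw [logDeriv_apply, h0, div_zero, Complex.zero_re] at this
    exact lt_irrefl _ this
  -- strict monotonicity of `log |ξ|` on the open ray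
  have hlog : StrictMonoOn (fun σ : ℝ => Real.log ‖riemannXi (σ + t * I)‖) (Ioi (1 / 2)) := by
    have hderiv : ∀ σ ∈ Ioi (1 / 2 : ℝ), HasDerivAt (fun σ : ℝ => Real.log ‖riemannXi (σ + t * I)‖)
        (logDeriv riemannXi (σ + t * I)).re σ := fun σ hσ =>
      Literature.Analysis.Complex.hasDerivAt_log_norm_horizontal
        (differentiable_riemannXi.analyticAt _) (hne σ hσ)
    refine strictMonoOn_of_deriv_pos (convex_Ioi _)
      (fun σ hσ => (hderiv σ hσ).continuousAt.continuousWithinAt) fun σ hσ => ?_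
    rw [interior_Ioi] at hσ
    rw [(hderiv σ hσ).deriv]
    exact h σ hσ
  have hopen : StrictMonoOn (fun σ : ℝ => ‖riemannXi (σ + t * I)‖) (Ioi (1 / 2)) := by
    intro a ha b hb hab
    have := hlog ha hb hab
    exact (Real.log_lt_log_iff (norm_pos_iff.2 (hne a ha)) (norm_pos_iff.2 (hne b hb))).1 this
  -- the endpoint `σ = 1/2` by continuity
  intro a ha b hb hab
  rcases (mem_Ici.1 ha).eq_or_lt with rfl | ha'
  · have hm : (1 / 2 : ℝ) < (1 / 2 + b) / 2 := by linarith
    have hmb : (1 / 2 + b) / 2 < b := by linarith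
    have hle : ‖riemannXi ((1 / 2 : ℝ) + t * I)‖ ≤ ‖riemannXi ((((1 / 2 + b) / 2 : ℝ) : ℂ) + t * I)‖ := by
      have hc : ContinuousWithinAt (fun σ : ℝ => ‖riemannXi (σ + t * I)‖) (Ioi (1 / 2)) (1 / 2) :=
        ((differentiable_riemannXi.continuous.comp (by fun_prop)).norm).continuousWithinAt
      refine le_of_tendsto hc ?_
      filter_upwards [Ioo_mem_nhdsGT hm] with σ hσ
      exact (hopen.le_iff_le hσ.1 hm).2 hσ.2.le
    exact lt_of_le_of_lt hle (hopen hm (lt_trans hm hmb) hmb)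
  · exact hopen ha' (lt_trans ha' hab) hab

/-! ### The crux ⟺ cofinite Lagarias positivity ⟺ cofinite horizontal monotonicity -/

/-- **crux ⟹ cofinite Lagarias positivity**: if only finitely many zeros are off the line, there is a
height `T` with `Re ξ'/ξ(σ + it) > 0` for all `σ > 1/2`, `|t| ≥ T`. [folklore] -/
theorem eventually_re_logDeriv_pos_of_cofinite (h : CofiniteCriticalLine) :
    ∃ T : ℝ, ∀ σ t : ℝ, 1 / 2 < σ → T ≤ |t| → 0 < (logDeriv riemannXi (σ + t * I)).re := by
  obtain ⟨M, hM⟩ := (h.image fun s : ℂ => |s.im|).bddAbove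
  refine ⟨M + 1 / 2, fun σ t hσ ht => re_logDeriv_riemannXi_pos_of_offLine_height hσ ?_⟩
  intro ρ hz h0 h1 hne
  have hρ : |ρ.im| ≤ M := hM ⟨ρ, ⟨hz, h0, h1, hne⟩, rfl⟩
  have := abs_sub_abs_le_abs_sub t ρ.im
  linarith

/-- **cofinite Lagarias positivity ⟹ crux** (cheap direction: `logDeriv` vanishes at a zero, so positivity
on `{σ > 1/2, |t| ≥ T}` excludes zeros there; reflect the left half by `s ↦ 1 − s`; bounded height ⟹
finitely many, Mathlib `IsCompact.inter_riemannZetaZeros_finite`). [folklore] -/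
theorem cofinite_of_eventually_re_logDeriv_pos {T : ℝ}
    (h : ∀ σ t : ℝ, 1 / 2 < σ → T ≤ |t| → 0 < (logDeriv riemannXi (σ + t * I)).re) :
    CofiniteCriticalLine := by
  have key : ∀ s : ℂ, riemannZeta s = 0 → 1 / 2 < s.re → s.re < 1 → T ≤ |s.im| → False := by
    intro s hz hs h1 hT
    have hξ : riemannXi s = 0 := (riemannXi_eq_zero_iff_holds s).2 ⟨hz, by linarith, h1⟩
    have := h s.re s.im hs hT
    rw [show ((s.re : ℂ) + s.im * I) = s from Complex.re_add_im s, logDeriv_apply, hξ, div_zero,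
      Complex.zero_re] at this
    exact lt_irrefl _ this
  exact cofinite_of_no_rightHalf_zero_above key

/-- **R1 as a theorem, (i)**: the crux is COFINITE LAGARIAS POSITIVITY. [folklore] -/
theorem cofiniteCriticalLine_iff_eventually_re_logDeriv_pos :
    CofiniteCriticalLine ↔
      ∃ T : ℝ, ∀ σ t : ℝ, 1 / 2 < σ → T ≤ |t| → 0 < (logDeriv riemannXi (σ + t * I)).re :=
  ⟨eventually_re_logDeriv_pos_of_cofinite, fun ⟨_, h⟩ => cofinite_of_eventually_re_logDeriv_pos h⟩

/-- **crux ⟹ cofinite Sondow–Dumitrescu / MSZ**: above some height, `σ ↦ |ξ(σ + it)|` is strictly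
increasing on the WHOLE half-line `[1/2, ∞)`. [folklore] -/
theorem eventually_strictMonoOn_of_cofinite (h : CofiniteCriticalLine) :
    ∃ T : ℝ, ∀ t : ℝ, T ≤ |t| → StrictMonoOn (fun σ : ℝ => ‖riemannXi (σ + t * I)‖) (Ici (1 / 2)) := by
  obtain ⟨T, hT⟩ := eventually_re_logDeriv_pos_of_cofinite h
  exact ⟨T, fun t ht => strictMonoOn_norm_riemannXi_of_re_logDeriv_pos fun σ hσ => hT σ t hσ ht⟩

/-- **monotonicity on a collar of width `≥ 1/2` ⟹ crux** (no rate/band hypothesis needed: every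
off-line zero `β + iγ`, `β > 1/2`, lies in the collar `[1/2, 1]`, where a monotone `|ξ|` vanishing at `β`
vanishes on `[1/2, β]`, contradicting the isolatedness of zeros of `ξ`; `ξ(0) = 1/2`). Stated for
`MonotoneOn` on `Icc (1/2) (1/2 + ε₀)`, `ε₀ ≥ 1/2`. [folklore] -/
theorem cofinite_of_eventually_monotoneOn {T ε₀ : ℝ} (hε₀ : 1 / 2 ≤ ε₀)
    (h : ∀ t : ℝ, T ≤ |t| → MonotoneOn (fun σ : ℝ => ‖riemannXi (σ + t * I)‖) (Icc (1 / 2) (1 / 2 + ε₀))) :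
    CofiniteCriticalLine := by
  have key : ∀ s : ℂ, riemannZeta s = 0 → 1 / 2 < s.re → s.re < 1 → T ≤ |s.im| → False := by
    intro s hz hs h1 hT
    have hmono := h s.im hT
    have hξs : riemannXi s = 0 := (riemannXi_eq_zero_iff_holds s).2 ⟨hz, by linarith, h1⟩
    -- `|ξ|` vanishes on the segment `[1/2, re s] + i·im s`
    have hzero : ∀ σ : ℝ, 1 / 2 ≤ σ → σ ≤ s.re → riemannXi (σ + s.im * I) = 0 := by
      intro σ h1σ hσs
      have hle := hmono ⟨h1σ, by linarith⟩ ⟨hs.le, by linarith⟩ hσs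
      simp only [Complex.re_add_im, hξs, norm_zero] at hle
      exact norm_eq_zero.1 (le_antisymm hle (norm_nonneg _))
    -- isolated zeros of the entire, not identically zero `ξ`
    have han : AnalyticAt ℂ riemannXi s := differentiable_riemannXi.analyticAt s
    rcases han.eventually_eq_zero_or_eventually_ne_zero with hev | hev
    · have hall := AnalyticOnNhd.eqOn_zero_of_preconnected_of_eventuallyEq_zero
        (fun z _ => differentiable_riemannXi.analyticAt z) isPreconnected_univ (mem_univ s) hev
      have h00 := hall (mem_univ (0 : ℂ))
      rw [riemannXi_zero] at h00
      norm_num at h00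
    · rw [eventually_nhdsWithin_iff, Metric.eventually_nhds_iff] at hev
      obtain ⟨δ, hδ, hδ'⟩ := hev
      set m : ℝ := min (δ / 2) ((s.re - 1 / 2) / 2) with hm
      have hm0 : 0 < m := lt_min (by linarith) (by linarith)
      have hz' := hzero (s.re - m) (by linarith [min_le_right (δ / 2) ((s.re - 1 / 2) / 2)])
        (by linarith)
      have hpt : (((s.re - m : ℝ) : ℂ) + s.im * I) = s - m := by
        apply Complex.ext <;> simp
      rw [hpt] at hz'
      refine hδ' (y := s - m) ?_ ?_ hz'
      · rw [dist_eq_norm, sub_sub_cancel_left, norm_neg, Complex.norm_real, Real.norm_eq_abs,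
          abs_of_pos hm0]
        linarith [min_le_left (δ / 2) ((s.re - 1 / 2) / 2)]
      · rw [mem_compl_singleton_iff, Ne, sub_eq_self]
        exact_mod_cast hm0.ne'
  exact cofinite_of_no_rightHalf_zero_above key

/-- **R1 as a theorem, (ii)**: the crux is COFINITE SONDOW–DUMITRESCU MONOTONICITY on the whole
half-line. [folklore] -/
theorem cofiniteCriticalLine_iff_eventually_strictMonoOn :
    CofiniteCriticalLine ↔
      ∃ T : ℝ, ∀ t : ℝ, T ≤ |t| → StrictMonoOn (fun σ : ℝ => ‖riemannXi (σ + t * I)‖) (Ici (1 / 2)) := by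
  refine ⟨eventually_strictMonoOn_of_cofinite, fun ⟨T, hT⟩ => ?_⟩
  refine cofinite_of_eventually_monotoneOn (ε₀ := 1 / 2) le_rfl (T := T) fun t ht => ?_
  exact ((hT t ht).mono (Icc_subset_Ici_self)).monotoneOn

/-! ### Consequences for the collar statements of idea `rate-band-collar-split` -/

/-- The idea's `FixedCollarMono ε₀ T` (body restated verbatim: monotonicity of
`x ↦ |ξ(1/2 + x + it)|` on `[0, ε₀]` for `|t| ≥ T`) FOLLOWS from the crux at EVERY width `ε₀`. [folklore] -/
theorem fixedCollarMono_of_cofinite (h : CofiniteCriticalLine) (ε₀ : ℝ) :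
    ∃ T : ℝ, ∀ t : ℝ, T ≤ |t| →
      MonotoneOn (fun x : ℝ => ‖riemannXi (1 / 2 + x + t * Complex.I)‖) (Set.Icc 0 ε₀) := by
  obtain ⟨T, hT⟩ := eventually_strictMonoOn_of_cofinite h
  refine ⟨T, fun t ht => ?_⟩
  intro x hx y hy hxy
  have hmono := (hT t ht).monotoneOn
  have := hmono (a := 1 / 2 + x) (b := 1 / 2 + y) (by simp [hx.1]) (by simp [hy.1]) (by linarith)
  simpa [Complex.ofReal_add] using this

/-- … and at any width `ε₀ ≥ 1/2` it IMPLIES the crux by itself (no `AsymptoticCriticalLine` needed):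
so `∃ T, FixedCollarMono ε₀ T` with `ε₀ ≥ 1/2` is the crux in costume. [folklore] -/
theorem cofinite_of_fixedCollarMono {T ε₀ : ℝ} (hε₀ : 1 / 2 ≤ ε₀)
    (h : ∀ t : ℝ, T ≤ |t| →
      MonotoneOn (fun x : ℝ => ‖riemannXi (1 / 2 + x + t * Complex.I)‖) (Set.Icc 0 ε₀)) :
    CofiniteCriticalLine := by
  refine cofinite_of_eventually_monotoneOn hε₀ (T := T) fun t ht => ?_
  intro a ha b hb hab
  have := h t ht (a := a - 1 / 2) (b := b - 1 / 2) ⟨by linarith [ha.1], by linarith [ha.2]⟩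
    ⟨by linarith [hb.1], by linarith [hb.2]⟩ (by linarith)
  simpa [Complex.ofReal_sub] using this

/-- Hence, for `ε₀ ≥ 1/2`: `(∃ T, FixedCollarMono ε₀ T) ↔ CofiniteCriticalLine`. [folklore] -/
theorem fixedCollarMono_iff_cofinite {ε₀ : ℝ} (hε₀ : 1 / 2 ≤ ε₀) :
    (∃ T : ℝ, ∀ t : ℝ, T ≤ |t| →
      MonotoneOn (fun x : ℝ => ‖riemannXi (1 / 2 + x + t * Complex.I)‖) (Set.Icc 0 ε₀)) ↔
    CofiniteCriticalLine :=
  ⟨fun ⟨_, h⟩ => cofinite_of_fixedCollarMono hε₀ h, fun h => fixedCollarMono_of_cofinite h ε₀⟩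

/-- At a single height: if no off-line zero has ordinate within `1/2` of `t`, then `σ ↦ |ξ(σ + it)|` is
strictly increasing on `[1/2, ∞)` — monotonicity across the collar at height `t` is decided by the off-line
zeros at heights within `1/2` of `t` (and by nothing else). [folklore] -/
theorem strictMonoOn_norm_riemannXi_of_offLine_height {t : ℝ}
    (hfar : ∀ ρ : ℂ, riemannZeta ρ = 0 → 0 < ρ.re → ρ.re < 1 → ρ.re ≠ 1 / 2 → 1 / 2 ≤ |t - ρ.im|) :
    StrictMonoOn (fun σ : ℝ => ‖riemannXi (σ + t * I)‖) (Ici (1 / 2)) :=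
  strictMonoOn_norm_riemannXi_of_re_logDeriv_pos fun _ hσ =>
    re_logDeriv_riemannXi_pos_of_offLine_height hσ hfar

/-- The idea's `CollarMono ε C T₂` (body verbatim: monotonicity on the shrinking collar
`[0, C|t|^{-ε}]` for `|t| ≥ T₂`) FOLLOWS from the crux at every rate `(ε, C)`: the near half of the split
`Cofinite ⇔ RateBand(η) ∧ CollarMono(η)` is implied by the crux, so given the far half it IS the crux.
[folklore] -/
theorem collarMono_of_cofinite (h : CofiniteCriticalLine) (ε C : ℝ) :
    ∃ T₂ : ℝ, ∀ t : ℝ, T₂ ≤ |t| →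
      MonotoneOn (fun x : ℝ => ‖riemannXi (1 / 2 + x + t * Complex.I)‖) (Set.Icc 0 (C * |t| ^ (-ε))) := by
  obtain ⟨T, hT⟩ := eventually_strictMonoOn_of_cofinite h
  refine ⟨T, fun t ht => ?_⟩
  intro x hx y hy hxy
  have hmono := (hT t ht).monotoneOn
  have := hmono (a := 1 / 2 + x) (b := 1 / 2 + y) (by simp [hx.1]) (by simp [hy.1]) (by linarith)
  simpa [Complex.ofReal_add] using this

/-- The idea's `RateBand ε C T₁` (body verbatim) FOLLOWS from the crux for every `ε` and every `C ≥ 0`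
(above the exceptional heights the left side vanishes). [folklore] -/
theorem rateBand_of_cofinite (h : CofiniteCriticalLine) (ε C : ℝ) (hC : 0 ≤ C) :
    ∃ T₁ : ℝ, ∀ s : ℂ, riemannZeta s = 0 → 0 < s.re → s.re < 1 → T₁ ≤ |s.im| →
      |s.re - 1 / 2| ≤ C * |s.im| ^ (-ε) := by
  obtain ⟨T, hT⟩ := cofiniteCriticalLine_iff_eventually_on_line.1 h
  refine ⟨T + 1, fun s hz h0 h1 hs => ?_⟩
  rw [hT s hz h0 h1 (by linarith), sub_self, abs_zero]
  exact mul_nonneg hC (Real.rpow_nonneg (abs_nonneg _) _)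

/-- Hence the idea's `SplitExact` (crux ⟹ both halves at every rate, `C > 0`) is a THEOREM: nothing is
lost by the split — and nothing is gained on the near half, which the crux gives for free. [folklore] -/
theorem splitExact_of_cofinite (h : CofiniteCriticalLine) (ε C : ℝ) (hC : 0 < C) :
    ∃ T : ℝ,
      (∀ s : ℂ, riemannZeta s = 0 → 0 < s.re → s.re < 1 → T ≤ |s.im| → |s.re - 1 / 2| ≤ C * |s.im| ^ (-ε)) ∧
      (∀ t : ℝ, T ≤ |t| →
        MonotoneOn (fun x : ℝ => ‖riemannXi (1 / 2 + x + t * Complex.I)‖) (Set.Icc 0 (C * |t| ^ (-ε)))) := by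
  obtain ⟨T₁, h₁⟩ := rateBand_of_cofinite h ε C hC.le
  obtain ⟨T₂, h₂⟩ := collarMono_of_cofinite h ε C
  exact ⟨max T₁ T₂, fun s hz h0 h1 hs => h₁ s hz h0 h1 (le_trans (le_max_left _ _) hs),
    fun t ht => h₂ t (le_trans (le_max_right _ _) ht)⟩

/-! ### Degenerate parameters of `RateBand ε C T` -/

/-- There are zeros ON the line at arbitrarily large height (Hardy's theorem, proved in tree, plus
discreteness of the zeros). [folklore] -/
theorem exists_zero_on_line_abs_im_ge (M : ℝ) : ∃ t : ℝ, M ≤ |t| ∧ riemannZeta (1 / 2 + t * I) = 0 := by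
  by_contra hcon
  push Not at hcon
  have hsub : {t : ℝ | riemannZeta (1 / 2 + t * I) = 0} ⊆
      (fun t : ℝ => (1 / 2 : ℂ) + t * I) ⁻¹'
        ((Icc (0 : ℝ) 1 ×ℂ Icc (-M) M) ∩ {s : ℂ | riemannZeta s = 0}) := by
    intro t ht
    have hM : |t| < M := lt_of_not_ge fun h => hcon t h ht
    refine ⟨Complex.mem_reProdIm.2 ⟨?_, ?_⟩, ht⟩
    · simp; norm_num
    · simpa using abs_le.1 hM.le
  refine hardy_infinite_zeros_on_critical_line_holds ((Set.Finite.preimage ?_ ?_).subset hsub)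
  · intro a _ b _ hab
    simpa using congrArg Complex.im hab
  · exact ((isCompact_Icc (a := (0 : ℝ)) (b := 1)).reProdIm (isCompact_Icc (a := -M) (b := M)))
      |>.inter_riemannZetaZeros_finite

/-- `RateBand ε C T` with `C < 0` is FALSE (a zero on the line above height `max T 1` has left side `0` and
right side `< 0`): the constant must be non-negative. [folklore] -/
theorem not_rateBand_of_neg {ε C T : ℝ} (hC : C < 0) :
    ¬ ∀ s : ℂ, riemannZeta s = 0 → 0 < s.re → s.re < 1 → T ≤ |s.im| →
      |s.re - 1 / 2| ≤ C * |s.im| ^ (-ε) := by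
  intro h
  obtain ⟨t, ht, hz⟩ := exists_zero_on_line_abs_im_ge (max T 1)
  have h1 : (1 : ℝ) ≤ |t| := le_trans (le_max_right _ _) ht
  have hle := h (1 / 2 + t * I) hz (by simp) (by simp; norm_num) (by simpa using le_trans (le_max_left _ _) ht)
  have him : ((1 / 2 : ℂ) + t * I).im = t := by simp
  have hre : ((1 / 2 : ℂ) + t * I).re = 1 / 2 := by simp
  rw [him, hre, sub_self, abs_zero] at hle
  have hpow : 0 < |t| ^ (-ε) := Real.rpow_pos_of_pos (by linarith) _
  nlinarith

/-- `RateBand ε 0 T` (constant `C = 0`) says "every zero of height `≥ T` is on the line": so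
`(∃ T, RateBand ε 0 T) ↔ CofiniteCriticalLine` — at `C = 0` the far half is the whole crux. [folklore] -/
theorem rateBand_zero_iff_cofinite (ε : ℝ) :
    (∃ T : ℝ, ∀ s : ℂ, riemannZeta s = 0 → 0 < s.re → s.re < 1 → T ≤ |s.im| →
      |s.re - 1 / 2| ≤ 0 * |s.im| ^ (-ε)) ↔ CofiniteCriticalLine := by
  constructor
  · rintro ⟨T, hT⟩
    refine cofiniteCriticalLine_iff_eventually_on_line.2 ⟨T, fun s hz h0 h1 hs => ?_⟩
    have := hT s hz h0 h1 hs.le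
    rw [zero_mul] at this
    have h0' : |s.re - 1 / 2| = 0 := le_antisymm this (abs_nonneg _)
    linarith [abs_eq_zero.1 h0']
  · intro h
    exact rateBand_of_cofinite h ε 0 le_rfl

/-- `RateBand ε C T` with a NEGATIVE exponent `ε < 0` (the "band" `C|t|^{-ε}` widens) and `C > 0` holds
unconditionally above some height (`|β − 1/2| < 1/2 ≤ C|t|^{|ε|}`): the exponent must be `≥ 0` for the far half
to say anything. [folklore] -/
theorem rateBand_of_neg_exponent {ε C : ℝ} (hε : ε < 0) (hC : 0 < C) :
    ∃ T : ℝ, ∀ s : ℂ, riemannZeta s = 0 → 0 < s.re → s.re < 1 → T ≤ |s.im| →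
      |s.re - 1 / 2| ≤ C * |s.im| ^ (-ε) := by
  set T₀ : ℝ := (1 / (2 * C)) ^ (1 / (-ε)) with hT₀
  have hT₀nn : 0 ≤ T₀ := Real.rpow_nonneg (by positivity) _
  have hT₀pow : T₀ ^ (-ε) = 1 / (2 * C) := by
    rw [hT₀, one_div (-ε)]
    exact Real.rpow_inv_rpow (by positivity) (by linarith)
  refine ⟨T₀, fun s _ h0 h1 hs => ?_⟩
  have hpow : 1 / (2 * C) ≤ |s.im| ^ (-ε) := by
    rw [← hT₀pow]
    exact Real.rpow_le_rpow hT₀nn hs (by linarith)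
  have hlt : |s.re - 1 / 2| ≤ 1 / 2 := by rw [abs_le]; constructor <;> linarith
  calc |s.re - 1 / 2| ≤ 1 / 2 := hlt
    _ = C * (1 / (2 * C)) := by field_simp
    _ ≤ C * |s.im| ^ (-ε) := by gcongr

/-- `CollarMono ε C T₂` with `C ≤ 0` is VACUOUS (the collar `[0, C|t|^{-ε}]` is at most the point `0`).
[folklore] -/
theorem collarMono_of_nonpos {ε C : ℝ} (hC : C ≤ 0) (T₂ : ℝ) :
    ∀ t : ℝ, T₂ ≤ |t| →
      MonotoneOn (fun x : ℝ => ‖riemannXi (1 / 2 + x + t * Complex.I)‖) (Set.Icc 0 (C * |t| ^ (-ε))) := by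
  intro t _ x hx y hy _
  have hC' : C * |t| ^ (-ε) ≤ 0 := mul_nonpos_of_nonpos_of_nonneg hC (Real.rpow_nonneg (abs_nonneg _) _)
  have hx0 : x = 0 := le_antisymm (le_trans hx.2 hC') hx.1
  have hy0 : y = 0 := le_antisymm (le_trans hy.2 hC') hy.1
  rw [hx0, hy0]


/-- THE NEAR HALF'S ENTIRE ZERO-SIDE CONTENT, pointwise: at the ordinate `γ₀` of an off-line zero
`ρ₀ = β₀ + iγ₀` with `β₀ > 1/2`, monotonicity of `x ↦ |ξ(1/2 + x + iγ₀)|` FAILS on every collar `[0, w]` with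
`w ≥ β₀ − 1/2` (a monotone `|ξ|` vanishing at `β₀ − 1/2` would vanish on `[0, β₀ − 1/2]`, and zeros of the entire
`ξ` are isolated, `ξ(0) = 1/2`). So `CollarMono(η)` at height `γ₀` IMPLIES "no off-line zero at height `γ₀`
within `η(γ₀)` of the line", and is implied by "no off-line zero at any height within `1/2` of `γ₀`"
(`strictMonoOn_norm_riemannXi_of_offLine_height`): nothing about `ξ` beyond the location of its zeros enters.
[folklore] -/
theorem not_monotoneOn_collar_at_offLine_zero {ρ : ℂ} (hz : riemannZeta ρ = 0) (hρ : 1 / 2 < ρ.re)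
    (h1 : ρ.re < 1) {w : ℝ} (hw : ρ.re - 1 / 2 ≤ w) :
    ¬ MonotoneOn (fun x : ℝ => ‖riemannXi (1 / 2 + x + ρ.im * Complex.I)‖) (Set.Icc 0 w) := by
  intro hmono
  have hξ : riemannXi ρ = 0 := (riemannXi_eq_zero_iff_holds ρ).2 ⟨hz, by linarith, h1⟩
  set a : ℝ := ρ.re - 1 / 2 with ha
  have ha0 : 0 < a := by rw [ha]; linarith
  have hρa : (1 / 2 + (a : ℂ) + ρ.im * I : ℂ) = ρ := by apply Complex.ext <;> simp [ha]
  -- `|ξ|` vanishes on the segment `[1/2, re ρ] + i·im ρ`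
  have hzero : ∀ x : ℝ, 0 ≤ x → x ≤ a → riemannXi (1 / 2 + x + ρ.im * I) = 0 := by
    intro x hx hxa
    have hle := hmono ⟨hx, le_trans hxa hw⟩ ⟨ha0.le, hw⟩ hxa
    simp only [hρa, hξ, norm_zero] at hle
    exact norm_eq_zero.1 (le_antisymm hle (norm_nonneg _))
  -- isolated zeros of the entire, not identically zero `ξ`
  have han : AnalyticAt ℂ riemannXi ρ := differentiable_riemannXi.analyticAt ρ
  rcases han.eventually_eq_zero_or_eventually_ne_zero with hev | hev
  · have hall := AnalyticOnNhd.eqOn_zero_of_preconnected_of_eventuallyEq_zero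
      (fun z _ => differentiable_riemannXi.analyticAt z) isPreconnected_univ (mem_univ ρ) hev
    have h00 := hall (mem_univ (0 : ℂ))
    rw [riemannXi_zero] at h00
    norm_num at h00
  · rw [eventually_nhdsWithin_iff, Metric.eventually_nhds_iff] at hev
    obtain ⟨δ, hδ, hδ'⟩ := hev
    set m : ℝ := min (δ / 2) (a / 2) with hm
    have hm0 : 0 < m := lt_min (by linarith) (by linarith)
    have hz' := hzero (a - m) (by linarith [min_le_right (δ / 2) (a / 2)]) (by linarith)
    have hpt : (1 / 2 + ((a - m : ℝ) : ℂ) + ρ.im * I : ℂ) = ρ - m := by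
      apply Complex.ext
      · simp [ha]; ring
      · simp
    rw [hpt] at hz'
    refine hδ' (y := ρ - m) ?_ ?_ hz'
    · rw [dist_eq_norm, sub_sub_cancel_left, norm_neg, Complex.norm_real, Real.norm_eq_abs, abs_of_pos hm0]
      linarith [min_le_left (δ / 2) (a / 2)]
    · rw [mem_compl_singleton_iff, Ne, sub_eq_self]
      exact_mod_cast hm0.ne'


end HorizontalMonotonicity

/-! ## §8 (cycle 2) Eventual all-orders Laguerre positivity of `|ξ|²` (idea `rate-band-collar-split`'s
"crude sufficient condition" for its near half) is at least the whole crux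

(Landed copy: `Theorems/CofiniteCriticalLine/Negative/LaguerreAllOrders.lean`, p77797.) -/

section LaguerreAllOrders

open Filter Topology
open scoped Nat

/-! ### Real restriction of an entire function: iterated derivatives -/

/-- If `G` is entire and real-valued on the real axis, `G ∘ ofReal = ofReal ∘ g`, then all iterated
derivatives commute with the restriction: `G⁽ᵏ⁾(x) = g⁽ᵏ⁾(x)` for real `x`. [folklore] -/
theorem iteratedDeriv_ofReal_eq {G : ℂ → ℂ} {g : ℝ → ℝ} (hG : Differentiable ℂ G)
    (h : ∀ x : ℝ, G x = g x) (k : ℕ) (x : ℝ) :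
    iteratedDeriv k G x = ((iteratedDeriv k g x : ℝ) : ℂ) := by
  induction k generalizing x with
  | zero => simpa using h x
  | succ k ih =>
    -- `G⁽ᵏ⁾` is entire
    have hGk : Differentiable ℂ (iteratedDeriv k G) := by
      rw [iteratedDeriv_eq_iterate]
      have hA : AnalyticOnNhd ℂ G univ := fun z _ => hG.analyticAt z
      exact fun z => ((hA.iterated_deriv k) z (mem_univ z)).differentiableAt
    set c : ℂ := iteratedDeriv (k + 1) G x with hc
    have hd : HasDerivAt (iteratedDeriv k G) c (x : ℂ) := by
      rw [hc, iteratedDeriv_succ]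
      exact (hGk x).hasDerivAt
    have hd' : HasDerivAt (fun y : ℝ => iteratedDeriv k G (y : ℂ)) c x := hd.comp_ofReal
    have hfun : (fun y : ℝ => iteratedDeriv k G (y : ℂ)) = fun y : ℝ => ((iteratedDeriv k g y : ℝ) : ℂ) :=
      funext fun y => ih y
    rw [hfun] at hd'
    -- real and imaginary parts of the derivative
    have hre : HasDerivAt (iteratedDeriv k g) c.re x := by
      have h1 := Complex.reCLM.hasFDerivAt.comp_hasDerivAt x hd'
      have h2 : (⇑Complex.reCLM ∘ fun y : ℝ => ((iteratedDeriv k g y : ℝ) : ℂ)) = iteratedDeriv k g := by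
        funext y; simp
      rw [h2, Complex.reCLM_apply] at h1
      convert h1 using 0
    have him0 : c.im = 0 := by
      have h1 := Complex.imCLM.hasFDerivAt.comp_hasDerivAt x hd'
      have h2 : (⇑Complex.imCLM ∘ fun y : ℝ => ((iteratedDeriv k g y : ℝ) : ℂ)) = fun _ => (0 : ℝ) := by
        funext y; simp
      rw [h2, Complex.imCLM_apply] at h1
      have h3 : HasDerivAt (fun _ : ℝ => (0 : ℝ)) (0 : ℝ) x := hasDerivAt_const x 0
      have := h1.unique h3
      exact this
    have hre' : iteratedDeriv (k + 1) g x = c.re := by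
      rw [iteratedDeriv_succ]
      exact hre.deriv
    apply Complex.ext
    · simp [hre']
    · simp [him0]

/-! ### The symmetric square `G(w) = ξ(1/2 + w + it) ξ(1/2 − w + it)` -/

/-- `ξ(1/2 − x + it) = conj ξ(1/2 + x + it)` for real `x, t` (`ξ(1 − s) = ξ(s)`, `ξ(s̄) = conj ξ(s)`).
[folklore] -/
theorem riemannXi_reflect_conj (x t : ℝ) :
    riemannXi (1 / 2 - x + t * I) = conj (riemannXi (1 / 2 + x + t * I)) := by
  have h1 : (1 / 2 - x + t * I : ℂ) = 1 - conj (1 / 2 + x + t * I) := by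
    apply Complex.ext <;> simp; ring
  rw [h1, riemannXi_one_sub, riemannXi_conj_holds]

/-- `|ξ|²` on the horizontal line as the restriction of the entire function
`G(w) = ξ(1/2 + w + it) ξ(1/2 − w + it)`. [folklore] -/
theorem symmSq_ofReal (t x : ℝ) :
    riemannXi (1 / 2 + x + t * I) * riemannXi (1 / 2 - x + t * I) =
      ((‖riemannXi (1 / 2 + x + t * I)‖ ^ 2 : ℝ) : ℂ) := by
  rw [riemannXi_reflect_conj, Complex.mul_conj, Complex.normSq_eq_norm_sq]

/-- `|ξ(1/2 + x + it)|²` is even in `x`. [folklore] -/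
theorem norm_sq_riemannXi_even (t x : ℝ) :
    ‖riemannXi (1 / 2 + ((-x : ℝ) : ℂ) + t * I)‖ ^ 2 = ‖riemannXi (1 / 2 + x + t * I)‖ ^ 2 := by
  have : (1 / 2 + ((-x : ℝ) : ℂ) + t * I : ℂ) = 1 / 2 - x + t * I := by push_cast; ring
  rw [this, riemannXi_reflect_conj, norm_conj]

/-! ### `EventualLaguerreAllOrders T₂ → CofiniteCriticalLine` -/

/-- **The idea's `EventualLaguerreAllOrders T₂` (body verbatim) implies the crux BY ITSELF** (no rate, band
or collar needed). Proof: at an off-line zero `β + it` (`β > 1/2`, `|t| ≥ T₂`) the even entire function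
`G(w) = ξ(1/2 + w + it)ξ(1/2 − w + it)` restricts to `g(x) = |ξ(1/2 + x + it)|²` on `ℝ`, so its Taylor
coefficients at `0` are `g⁽ⁿ⁾(0)/n!` — zero for odd `n` (evenness), `≥ 0` for even `n` (hypothesis); the Taylor
series at the point `β − 1/2 > 0` sums to `g(β − 1/2) = |ξ(β + it)|² = 0`, forcing every coefficient to
vanish, so `G ≡ 0`, contradicting `ξ ≠ 0` on `re s ≥ 1`. So, like `FixedCollarMono (ε₀ ≥ 1/2)`, this
"sufficient condition for the near half" is at least the whole crux. [folklore] -/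
theorem cofinite_of_eventualLaguerreAllOrders {T₂ : ℝ}
    (h : ∀ t : ℝ, T₂ ≤ |t| → ∀ n : ℕ,
      0 ≤ iteratedDeriv (2 * n) (fun x : ℝ => ‖riemannXi (1 / 2 + x + t * Complex.I)‖ ^ 2) 0) :
    CofiniteCriticalLine := by
  -- bookkeeping: it suffices to exclude zeros with `1/2 < re s < 1` of height `≥ T₂` (reflect the left half
  -- by `s ↦ 1 - s`; zeros of bounded height are finitely many)
  suffices key : ∀ s : ℂ, riemannZeta s = 0 → 1 / 2 < s.re → s.re < 1 → T₂ ≤ |s.im| → False by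
    refine (((isCompact_Icc (a := (0 : ℝ)) (b := 1)).reProdIm
      (isCompact_Icc (a := -T₂) (b := T₂))).inter_riemannZetaZeros_finite).subset ?_
    rintro s ⟨hz, h0, h1, hne⟩
    refine ⟨Complex.mem_reProdIm.2 ⟨⟨h0.le, h1.le⟩, abs_le.1 (le_of_not_gt fun hT => ?_)⟩, hz⟩
    rcases lt_or_gt_of_ne hne with hlt | hgt
    · refine key (1 - s) (GeneralizedRH.riemannZeta_one_sub_eq_zero hz h0 h1) ?_ ?_ ?_
      · simp only [sub_re, one_re]; linarith
      · simp only [sub_re, one_re]; linarith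
      · simp only [sub_im, one_im, zero_sub, abs_neg]; exact hT.le
    · exact key s hz hgt h1 hT.le
  intro s hz hs h1 hT
  set t : ℝ := s.im with ht
  set g : ℝ → ℝ := fun x : ℝ => ‖riemannXi (1 / 2 + x + t * Complex.I)‖ ^ 2 with hg
  set G : ℂ → ℂ := fun w : ℂ => riemannXi (1 / 2 + w + t * I) * riemannXi (1 / 2 - w + t * I) with hG
  have hGg : ∀ x : ℝ, G x = g x := fun x => symmSq_ofReal t x
  have hGd : Differentiable ℂ G := by
    have h1 : Differentiable ℂ fun w : ℂ => riemannXi (1 / 2 + w + t * I) :=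
      differentiable_riemannXi.comp ((differentiable_id.const_add _).add_const _)
    have h2 : Differentiable ℂ fun w : ℂ => riemannXi (1 / 2 - w + t * I) :=
      differentiable_riemannXi.comp ((differentiable_id.const_sub _).add_const _)
    exact h1.mul h2
  -- Taylor coefficients at 0 are real: `G⁽ⁿ⁾(0) = g⁽ⁿ⁾(0)`
  have hcoef : ∀ n : ℕ, iteratedDeriv n G 0 = ((iteratedDeriv n g 0 : ℝ) : ℂ) := by
    intro n
    have := iteratedDeriv_ofReal_eq hGd hGg n 0
    simpa using this
  -- odd coefficients vanish (g is even)
  have heven : (fun x : ℝ => g (-x)) = g := by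
    funext x
    simp only [hg]
    have := norm_sq_riemannXi_even t x
    push_cast at this ⊢
    exact this
  have hodd : ∀ n : ℕ, iteratedDeriv (2 * n + 1) g 0 = 0 := by
    intro n
    have h1 := iteratedDeriv_comp_neg (2 * n + 1) g 0
    rw [heven, neg_zero, smul_eq_mul, pow_succ, pow_mul] at h1
    norm_num at h1
    linarith
  -- all coefficients are ≥ 0
  have hnonneg : ∀ n : ℕ, 0 ≤ iteratedDeriv n g 0 := by
    intro n
    rcases Nat.even_or_odd n with ⟨m, rfl⟩ | ⟨m, rfl⟩
    · have := h t hT m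
      rw [two_mul] at this
      exact this
    · rw [hodd m]
  -- the zero: `g (β - 1/2) = 0`
  set a : ℝ := s.re - 1 / 2 with ha
  have ha0 : 0 < a := by rw [ha]; linarith
  have hsa : (1 / 2 + (a : ℂ) + t * I : ℂ) = s := by
    apply Complex.ext <;> simp [ha, ht]
  have hξs : riemannXi s = 0 := (riemannXi_eq_zero_iff_holds s).2 ⟨hz, by linarith, h1⟩
  have hga : g a = 0 := by simp only [hg, hsa, hξs, norm_zero]; norm_num
  -- Taylor expansion of `G` at `0`, evaluated at `a`
  have htaylor := Complex.hasSum_taylorSeries_of_entire hGd 0 (a : ℂ)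
  rw [hGg a, hga] at htaylor
  have hterm : ∀ n : ℕ, ((n ! : ℂ)⁻¹ • ((a : ℂ) - 0) ^ n • iteratedDeriv n G 0) =
      (((n ! : ℝ)⁻¹ * a ^ n * iteratedDeriv n g 0 : ℝ) : ℂ) := by
    intro n
    rw [hcoef n, sub_zero, smul_eq_mul, smul_eq_mul]
    push_cast
    ring
  have hsumR : HasSum (fun n : ℕ => (n ! : ℝ)⁻¹ * a ^ n * iteratedDeriv n g 0) 0 := by
    have h2 : HasSum (fun n : ℕ => (((n ! : ℝ)⁻¹ * a ^ n * iteratedDeriv n g 0 : ℝ) : ℂ)) ((0 : ℝ) : ℂ) := by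
      rw [Complex.ofReal_zero]
      exact htaylor.congr_fun fun n => (hterm n).symm
    exact Complex.hasSum_ofReal.1 h2
  have hterm0 : ∀ n : ℕ, (n ! : ℝ)⁻¹ * a ^ n * iteratedDeriv n g 0 = 0 := by
    have hnn : ∀ n : ℕ, 0 ≤ (n ! : ℝ)⁻¹ * a ^ n * iteratedDeriv n g 0 := fun n =>
      mul_nonneg (mul_nonneg (inv_nonneg.2 (Nat.cast_nonneg _)) (pow_nonneg ha0.le _)) (hnonneg n)
    have := (hasSum_zero_iff_of_nonneg hnn).1 hsumR
    exact fun n => congrFun this n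
  have hcoef0 : ∀ n : ℕ, iteratedDeriv n G 0 = 0 := by
    intro n
    have h3 := hterm0 n
    have hfac : (n ! : ℝ)⁻¹ * a ^ n ≠ 0 :=
      mul_ne_zero (inv_ne_zero (by exact_mod_cast (Nat.factorial_pos n).ne')) (pow_ne_zero _ ha0.ne')
    rcases mul_eq_zero.1 h3 with h4 | h4
    · exact absurd h4 hfac
    · rw [hcoef n, h4, Complex.ofReal_zero]
  -- hence `G ≡ 0`
  have hG0 : ∀ z : ℂ, G z = 0 := by
    intro z
    have hz' := Complex.hasSum_taylorSeries_of_entire hGd 0 z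
    simp only [hcoef0, smul_zero] at hz'
    exact (hz'.unique hasSum_zero)
  -- but `G 1 = ξ(3/2 + it) ξ(-1/2 + it) ≠ 0`
  have hG1 := hG0 1
  simp only [hG] at hG1
  rcases mul_eq_zero.1 hG1 with h5 | h5
  · have := ((riemannXi_eq_zero_iff_holds _).1 h5).2.2
    simp at this
    norm_num at this
  · have := ((riemannXi_eq_zero_iff_holds _).1 h5).2.1
    simp at this
    norm_num at this


end LaguerreAllOrders

end Summit.RiemannHypothesis.RiemannHypothesis.Cruxes.CofiniteCriticalLine.Disproof

end
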